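import Literature.RepresentationTheory.ClassicalInvariants.TensorFFTLetterColoured
import Literature.RingTheory.SimpleModule.InvolutionWedderburnBlocks
import Mathlib.LinearAlgebra.Matrix.ToLin
import Mathlib.LinearAlgebra.Matrix.BilinearForm
import Mathlib.LinearAlgebra.Matrix.NonsingularInverse
import HarnessLib

/-!
# Adapted letter colourings of a self-adjoint split semisimple algebra of operators

Let `B` be a non-degenerate alternating form on a finite-dimensional `K`-space `V` (`K` of characteristic `0`),
and `E ⊆ End_K V` a split semisimple subalgebra (`E ≃ₐ[K] Π Matrix`) stable under the `B`-adjoint `†`.  Following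
[Milne 1999, §2] (decomposition of `(E, †)` into simple factors of symplectic / orthogonal type — the self-dual
blocks `1_i† = 1_i` — and unitary type — the pairs `{1_i, 1_i†}` with `1_i† ≠ 1_i`) we construct an **adapted
basis** `β : Fin N → V` and a colouring of the letters `Fin N` such that, colour by colour,

* (form colours) the letters are `ltr(s, a) ↔ e^i_{s0} u_a` (`s` a slot = row index of the matrix block, `a` a
  letter of the multiplicity space `U_i = e^i_{00} V`), the Gram matrix of `B` factorises as `φ_{s s'} Ω_{a a'}`
  with `Ω` symmetric or alternating and non-degenerate, every `G ∈ formBlockGroup ltr Ω` (F2 =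
  `TensorFFTLetterColoured`) is the matrix in `β` of an `E`-linear `B`-isometry, and every kernel in
  `formBlockKernels ltr Ω` is the contraction matrix of an element of `E`;
* (pair colours) the letters are `vec(s, a) ↔ e^i_{s0} u_a`, `cov(s, a) ↔ (e^i_{0s})† u'_a` with dual letter bases
  `B (u_{a'}) (u'_a) = δ`, every `G ∈ glBlockGroup vec cov` is the matrix of an `E`-linear `B`-isometry and every
  kernel in `glBlockKernels vec cov` is the contraction matrix of `e^i_{s s'} + (e^i_{s s'})† ∈ E`.

This is the structure statement behind [Milne 1999, Thm. 3.2 / Cor. 4.5] ("the invariants of the centralizer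
of a semisimple algebra with involution in the tensor algebra are generated in degree 2"), in the exact
vocabulary of the letter-coloured tensor FFT of `TensorFFTLetterColoured`.  Main result:
`exists_adaptedColouring`.

## References
* [Milne 1999] J. S. Milne, *Lefschetz classes on abelian varieties*, Duke Math. J. 96 (1999), §2 and §3
  (Prop. 3.6, Thm. 3.2). [cite: Milne1999LefschetzClasses, §2–§3]
* R. Goodman, N. Wallach, *Symmetry, Representations, and Invariants*, GTM 255, §4.1 and §5.3.
  [cite: GoodmanWallachGTM255, §4.1]
-/

noncomputable section

namespace Literature.RepresentationTheory.ClassicalInvariants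

open Literature.RingTheory.SimpleModule Matrix
open scoped BigOperators Matrix

variable {K : Type*} [Field K] {V : Type*} [AddCommGroup V] [Module K V] [FiniteDimensional K V]

/-! ### The bundled hypotheses -/

variable (K V) in
/-- The data of [Milne 1999, §2]: a non-degenerate alternating form, a `†`-stable subalgebra of operators and a
Wedderburn splitting of it. [cite: Milne1999LefschetzClasses, §2] -/
structure Setup where
  /-- the alternating form -/
  B : LinearMap.BilinForm K V
  /-- non-degeneracy -/
  hB : B.Nondegenerate
  /-- alternating -/
  hBa : B.IsAlt
  /-- the algebra of operators -/
  E : Subalgebra K (Module.End K V)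
  /-- `†`-stability -/
  hE : ∀ X ∈ E, adj B hB X ∈ E
  /-- number of Wedderburn blocks -/
  t : ℕ
  /-- sizes of the blocks -/
  d : Fin t → ℕ
  /-- the sizes are positive -/
  hd : ∀ i, NeZero (d i)
  /-- the Wedderburn isomorphism -/
  ψ : E ≃ₐ[K] Π i, Matrix (Fin (d i)) (Fin (d i)) K

namespace Setup

variable (S : Setup K V)

/-- Block sizes are positive. [folklore] -/
instance (i : Fin S.t) : NeZero (S.d i) := S.hd i

/-- The block involution. [cite: Milne1999LefschetzClasses, §2] -/
def bar (i : Fin S.t) : Fin S.t :=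
  Literature.RingTheory.SimpleModule.bar S.B S.hB S.hBa S.E S.hE S.hd S.ψ i

/-- `bar` is an involution. [cite: Milne1999LefschetzClasses, §2] -/
theorem bar_bar (i : Fin S.t) : S.bar (S.bar i) = i :=
  Literature.RingTheory.SimpleModule.bar_bar S.B S.hB S.hBa S.E S.hE S.hd S.ψ i

/-- `(1_i)† = 1_{bar i}`. [cite: Milne1999LefschetzClasses, §2] -/
theorem adj_blockIdem (i : Fin S.t) :
    adj S.B S.hB (blockIdem S.E S.ψ i) = blockIdem S.E S.ψ (S.bar i) :=
  Literature.RingTheory.SimpleModule.adj_blockIdem S.B S.hB S.hBa S.E S.hE S.hd S.ψ i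

/-- Vectors in blocks `i`, `j ≠ bar i` are orthogonal. [cite: Milne1999LefschetzClasses, §2] -/
theorem form_eq_zero_of_blocks {i j : Fin S.t} (h : j ≠ S.bar i) {v w : V}
    (hv : blockIdem S.E S.ψ i v = v) (hw : blockIdem S.E S.ψ j w = w) : S.B v w = 0 := by
  rw [← hv, ← hw]
  exact form_blockIdem_blockIdem S.B S.hB S.hBa S.E S.hE S.hd S.ψ h v w

/-- Moving an operator across `B`. [cite: Milne1999LefschetzClasses, §2] -/
theorem form_apply_left (X : Module.End K V) (v w : V) : S.B (X v) w = S.B v (adj S.B S.hB X w) :=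
  adj_spec' S.B S.hB S.hBa X v w

/-- Moving an adjoint across `B`. [cite: Milne1999LefschetzClasses, §2] -/
theorem form_apply_right (X : Module.End K V) (v w : V) : S.B v (adj S.B S.hB X w) = S.B (X v) w :=
  (adj_spec' S.B S.hB S.hBa X v w).symm

/-! ### Colours -/

/-- The colours: representatives `i ≤ bar i` of the orbits of `bar`. [cite: Milne1999LefschetzClasses, §2] -/
def Colour : Type := {i : Fin S.t // i ≤ S.bar i}

/-- Finitely many colours. [folklore] -/
instance : Fintype S.Colour := by unfold Colour; infer_instance

/-- Colours have decidable equality. [folklore] -/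
instance : DecidableEq S.Colour := by unfold Colour; infer_instance

/-- Form colours are the self-dual blocks (types Sp / O); the others are the unitary pairs.
[cite: Milne1999LefschetzClasses, §2] -/
def IsForm (c : S.Colour) : Prop := S.bar c.1 = c.1

/-- Being a form colour is decidable. [folklore] -/
instance : DecidablePred S.IsForm := fun c => by unfold IsForm; infer_instance

/-- The first slot index of a colour. [folklore] -/
def z (c : S.Colour) : Fin (S.d c.1) := 0

/-- The matrix units `e_{ab}` of the representative block of a colour. [cite: Milne1999LefschetzClasses, §2] -/
def e (c : S.Colour) (a b : Fin (S.d c.1)) : Module.End K V := unit S.E S.ψ c.1 a b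

/-- The transported units `f_{ab} = (e_{ba})†` of the partner block. [cite: Milne1999LefschetzClasses, §2] -/
def f (c : S.Colour) (a b : Fin (S.d c.1)) : Module.End K V := adj S.B S.hB (unit S.E S.ψ c.1 b a)

/-- Multiplication table of the `e`'s. [cite: Milne1999LefschetzClasses, §2] -/
theorem e_mul_e (c : S.Colour) (a b b' d : Fin (S.d c.1)) :
    S.e c a b * S.e c b' d = if b = b' then S.e c a d else 0 :=
  unit_mul_unit S.E S.ψ c.1 a b b' d

/-- Multiplication table of the `f`'s. [cite: Milne1999LefschetzClasses, §2] -/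
theorem f_mul_f (c : S.Colour) (a b b' d : Fin (S.d c.1)) :
    S.f c a b * S.f c b' d = if b = b' then S.f c a d else 0 := by
  unfold f
  rw [← adj_mul, unit_mul_unit]
  split_ifs with h1 h2 h2
  · rfl
  · exact absurd h1.symm h2
  · exact absurd h2.symm h1
  · exact adj_zero S.B S.hB

/-- `e`'s lie in `E`. [cite: Milne1999LefschetzClasses, §2] -/
theorem e_mem (c : S.Colour) (a b : Fin (S.d c.1)) : S.e c a b ∈ S.E := unit_mem S.E S.ψ c.1 a b

/-- `f`'s lie in `E`. [cite: Milne1999LefschetzClasses, §2] -/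
theorem f_mem (c : S.Colour) (a b : Fin (S.d c.1)) : S.f c a b ∈ S.E := S.hE _ (unit_mem S.E S.ψ c.1 b a)

/-- `e`'s live in the block `c.1`. [cite: Milne1999LefschetzClasses, §2] -/
theorem blockIdem_mul_e (c : S.Colour) (a b : Fin (S.d c.1)) :
    blockIdem S.E S.ψ c.1 * S.e c a b = S.e c a b :=
  blockIdem_mul_unit S.E S.ψ c.1 a b

/-- `f`'s live in the block `bar c.1`. [cite: Milne1999LefschetzClasses, §2] -/
theorem blockIdem_mul_f (c : S.Colour) (a b : Fin (S.d c.1)) :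
    blockIdem S.E S.ψ (S.bar c.1) * S.f c a b = S.f c a b := by
  unfold f
  rw [← S.adj_blockIdem, ← adj_mul, unit_mul_blockIdem]

/-- An operator of block `j` kills vectors of block `i ≠ j`. [cite: Milne1999LefschetzClasses, §2] -/
theorem apply_eq_zero_of_blocks {i j : Fin S.t} (h : i ≠ j) {X : Module.End K V}
    (hX : X * blockIdem S.E S.ψ j = X) {v : V} (hv : blockIdem S.E S.ψ i v = v) : X v = 0 := by
  rw [← hX, ← hv, Module.End.mul_apply, ← Module.End.mul_apply (blockIdem S.E S.ψ j),
    blockIdem_mul_blockIdem, if_neg (Ne.symm h), LinearMap.zero_apply, map_zero]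

/-- `e`'s absorb their block idempotent on the right. [cite: Milne1999LefschetzClasses, §2] -/
theorem e_mul_blockIdem (c : S.Colour) (a b : Fin (S.d c.1)) :
    S.e c a b * blockIdem S.E S.ψ c.1 = S.e c a b :=
  unit_mul_blockIdem S.E S.ψ c.1 a b

/-- `f`'s absorb their block idempotent on the right. [cite: Milne1999LefschetzClasses, §2] -/
theorem f_mul_blockIdem (c : S.Colour) (a b : Fin (S.d c.1)) :
    S.f c a b * blockIdem S.E S.ψ (S.bar c.1) = S.f c a b := by
  unfold f
  rw [← S.adj_blockIdem, ← adj_mul, blockIdem_mul_unit]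

/-! ### Letters: a basis of the multiplicity space and its dual -/

/-- The multiplicity space `U_c = e_{00} V` of a colour. [cite: Milne1999LefschetzClasses, §2] -/
def U (c : S.Colour) : Submodule K V := LinearMap.range (S.e c (S.z c) (S.z c))

/-- The dual multiplicity space `U'_c = f_{00} V`. [cite: Milne1999LefschetzClasses, §2] -/
def U' (c : S.Colour) : Submodule K V := LinearMap.range (S.f c (S.z c) (S.z c))

/-- The number of letters of a colour. [cite: Milne1999LefschetzClasses, §2] -/
def n (c : S.Colour) : ℕ := Module.finrank K (S.U c)

/-- The letters `u_a` of a colour: a basis of `U_c`. [cite: Milne1999LefschetzClasses, §2] -/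
def u (c : S.Colour) (a : Fin (S.n c)) : V := ↑(Module.finBasis K (S.U c) a)

/-- Letters lie in `U_c`. [cite: Milne1999LefschetzClasses, §2] -/
theorem u_mem (c : S.Colour) (a : Fin (S.n c)) : S.u c a ∈ S.U c := (Module.finBasis K (S.U c) a).2

/-- `e_{00}` fixes `U_c`. [cite: Milne1999LefschetzClasses, §2] -/
theorem e_apply_of_mem_U (c : S.Colour) {v : V} (hv : v ∈ S.U c) : S.e c (S.z c) (S.z c) v = v := by
  obtain ⟨w, rfl⟩ := hv
  rw [← Module.End.mul_apply, S.e_mul_e, if_pos rfl]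

/-- `f_{00}` fixes `U'_c`. [cite: Milne1999LefschetzClasses, §2] -/
theorem f_apply_of_mem_U' (c : S.Colour) {v : V} (hv : v ∈ S.U' c) : S.f c (S.z c) (S.z c) v = v := by
  obtain ⟨w, rfl⟩ := hv
  rw [← Module.End.mul_apply, S.f_mul_f, if_pos rfl]

/-- `U_c` and `U'_c` are in perfect duality under `B` (right kernel). [cite: Milne1999LefschetzClasses, §2] -/
theorem eq_zero_of_forall_U {c : S.Colour} {y : V} (hy : y ∈ S.U' c) (h : ∀ x ∈ S.U c, S.B x y = 0) :
    y = 0 := by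
  refine S.hB.2 y fun x => ?_
  rw [← S.f_apply_of_mem_U' c hy, f, S.form_apply_right]
  exact h _ (LinearMap.mem_range_self _ x)

/-- `U_c` and `U'_c` are in perfect duality under `B` (left kernel). [cite: Milne1999LefschetzClasses, §2] -/
theorem eq_zero_of_forall_U' {c : S.Colour} {x : V} (hx : x ∈ S.U c) (h : ∀ y ∈ S.U' c, S.B x y = 0) :
    x = 0 := by
  refine S.hB.1 x fun y => ?_
  rw [← S.e_apply_of_mem_U c hx, e, S.form_apply_left]
  exact h _ (LinearMap.mem_range_self _ y)

/-- The coordinate map `y ↦ (B (u_a) y)_a` on `U'_c`. [cite: Milne1999LefschetzClasses, §2] -/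
def ρ (c : S.Colour) : S.U' c →ₗ[K] (Fin (S.n c) → K) :=
  LinearMap.pi fun a => (S.B (S.u c a)).comp (S.U' c).subtype

/-- Unfolding `ρ`. [folklore] -/
@[simp] private theorem ρ_apply (c : S.Colour) (y : S.U' c) (a : Fin (S.n c)) : S.ρ c y a = S.B (S.u c a) y := rfl

/-- The letters span `U_c`. [cite: Milne1999LefschetzClasses, §2] -/
theorem span_u (c : S.Colour) : Submodule.span K (Set.range (S.u c)) = S.U c := by
  have h : Set.range (S.u c) = (S.U c).subtype '' Set.range (Module.finBasis K (S.U c)) := by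
    rw [← Set.range_comp]; rfl
  rw [h, Submodule.span_image, (Module.finBasis K (S.U c)).span_eq, Submodule.map_subtype_top]

/-- The letters are linearly independent. [cite: Milne1999LefschetzClasses, §2] -/
theorem linearIndependent_u (c : S.Colour) : LinearIndependent K (S.u c) :=
  (Module.finBasis K (S.U c)).linearIndependent.map' (S.U c).subtype (Submodule.ker_subtype _)

/-- A vector orthogonal to all letters is orthogonal to `U_c`. [folklore] -/
private theorem form_eq_zero_of_forall_u (c : S.Colour) {w : V} (h : ∀ a, S.B (S.u c a) w = 0) :
    ∀ x ∈ S.U c, S.B x w = 0 := by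
  intro x hx
  rw [← S.span_u c] at hx
  refine Submodule.span_induction (p := fun x _ => S.B x w = 0) ?_ ?_ ?_ ?_ hx
  · rintro _ ⟨a, rfl⟩; exact h a
  · exact LinearMap.BilinForm.zero_left _
  · intro x₁ x₂ _ _ h1 h2; rw [LinearMap.BilinForm.add_left, h1, h2, add_zero]
  · intro r x _ hx; rw [LinearMap.BilinForm.smul_left, hx, mul_zero]

/-- `ρ` is injective. [cite: Milne1999LefschetzClasses, §2] -/
theorem ρ_injective (c : S.Colour) : Function.Injective (S.ρ c) := by
  intro y y' h
  have hw : (↑y - ↑y' : V) = 0 := by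
    apply S.eq_zero_of_forall_U (Submodule.sub_mem _ y.2 y'.2)
    apply S.form_eq_zero_of_forall_u
    intro a
    rw [LinearMap.BilinForm.sub_right, sub_eq_zero]
    exact congrFun h a
  exact Subtype.ext (sub_eq_zero.1 hw)

/-- `dim U'_c ≤ dim U_c`. [cite: Milne1999LefschetzClasses, §2] -/
theorem finrank_U'_le (c : S.Colour) : Module.finrank K (S.U' c) ≤ S.n c := by
  have := LinearMap.finrank_le_finrank_of_injective (S.ρ_injective c)
  rwa [Module.finrank_fintype_fun_eq_card, Fintype.card_fin] at this

/-- The reverse coordinate map `x ↦ (B x (b_k))_k` on `U_c`, `b` a basis of `U'_c`. [folklore] -/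
def ρ' (c : S.Colour) : S.U c →ₗ[K] (Fin (Module.finrank K (S.U' c)) → K) :=
  LinearMap.pi fun k => (S.B.flip ↑(Module.finBasis K (S.U' c) k)).comp (S.U c).subtype

/-- `ρ'` is injective. [folklore] -/
private theorem ρ'_injective (c : S.Colour) : Function.Injective (S.ρ' c) := by
  intro x x' h
  have hw : (↑x - ↑x' : V) = 0 := by
    apply S.eq_zero_of_forall_U' (Submodule.sub_mem _ x.2 x'.2)
    intro y hy
    have hy' : y ∈ Submodule.span K (Set.range fun k => (↑(Module.finBasis K (S.U' c) k) : V)) := by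
      have h2 : Set.range (fun k => (↑(Module.finBasis K (S.U' c) k) : V)) =
          (S.U' c).subtype '' Set.range (Module.finBasis K (S.U' c)) := by
        rw [← Set.range_comp]; rfl
      rw [h2, Submodule.span_image, (Module.finBasis K (S.U' c)).span_eq, Submodule.map_subtype_top]
      exact hy
    have hk : ∀ k, S.B (↑x - ↑x') ↑(Module.finBasis K (S.U' c) k) = 0 := fun k => by
      rw [LinearMap.BilinForm.sub_left, sub_eq_zero]
      exact congrFun h k
    refine Submodule.span_induction (p := fun y _ => S.B (↑x - ↑x') y = 0) ?_ ?_ ?_ ?_ hy'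
    · rintro _ ⟨k, rfl⟩; exact hk k
    · exact LinearMap.BilinForm.zero_right _
    · intro y₁ y₂ _ _ h1 h2; rw [LinearMap.BilinForm.add_right, h1, h2, add_zero]
    · intro r y _ hy; rw [LinearMap.BilinForm.smul_right, hy, mul_zero]
  exact Subtype.ext (sub_eq_zero.1 hw)

/-- `dim U'_c = dim U_c`. [cite: Milne1999LefschetzClasses, §2] -/
theorem finrank_U' (c : S.Colour) : Module.finrank K (S.U' c) = S.n c := by
  refine le_antisymm (S.finrank_U'_le c) ?_
  have := LinearMap.finrank_le_finrank_of_injective (S.ρ'_injective c)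
  rwa [Module.finrank_fintype_fun_eq_card, Fintype.card_fin] at this

/-- `ρ` is bijective: `U_c` and `U'_c` are in perfect duality. [cite: Milne1999LefschetzClasses, §2] -/
theorem ρ_bijective (c : S.Colour) : Function.Bijective (S.ρ c) :=
  ⟨S.ρ_injective c, (LinearMap.injective_iff_surjective_of_finrank_eq_finrank
    (by rw [S.finrank_U', Module.finrank_fintype_fun_eq_card, Fintype.card_fin])).1 (S.ρ_injective c)⟩

/-- `ρ` as a linear equivalence. [folklore] -/
def ρEquiv (c : S.Colour) : S.U' c ≃ₗ[K] (Fin (S.n c) → K) :=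
  LinearEquiv.ofBijective (S.ρ c) (S.ρ_bijective c)

/-- The dual letters `u'_a ∈ U'_c`, `B (u_{a'}) (u'_a) = δ_{a' a}`. [cite: Milne1999LefschetzClasses, §2] -/
def u' (c : S.Colour) (a : Fin (S.n c)) : V := ↑((S.ρEquiv c).symm (Pi.single a 1))

/-- Dual letters lie in `U'_c`. [cite: Milne1999LefschetzClasses, §2] -/
theorem u'_mem (c : S.Colour) (a : Fin (S.n c)) : S.u' c a ∈ S.U' c := ((S.ρEquiv c).symm _).2

/-- The duality of the letter bases. [cite: Milne1999LefschetzClasses, §2] -/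
theorem B_u_u' (c : S.Colour) (a a' : Fin (S.n c)) :
    S.B (S.u c a') (S.u' c a) = if a' = a then 1 else 0 := by
  have h : S.ρ c ((S.ρEquiv c).symm (Pi.single a 1)) = Pi.single a 1 :=
    (S.ρEquiv c).apply_symm_apply _
  have h2 := congrFun h a'
  rw [ρ_apply, Pi.single_apply] at h2
  exact h2

/-- The dual letters span `U'_c`. [cite: Milne1999LefschetzClasses, §2] -/
theorem span_u' (c : S.Colour) : Submodule.span K (Set.range (S.u' c)) = S.U' c := by
  have hb := ((Pi.basisFun K (Fin (S.n c))).map (S.ρEquiv c).symm).span_eq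
  have h : Set.range (S.u' c) =
      (S.U' c).subtype '' Set.range ((Pi.basisFun K (Fin (S.n c))).map (S.ρEquiv c).symm) := by
    rw [← Set.range_comp]
    congr 1
    funext a
    simp only [u', Function.comp_apply, Module.Basis.map_apply, Pi.basisFun_apply, Submodule.coe_subtype]
  rw [h, Submodule.span_image, hb, Submodule.map_subtype_top]

/-- The dual letters are linearly independent. [cite: Milne1999LefschetzClasses, §2] -/
theorem linearIndependent_u' (c : S.Colour) : LinearIndependent K (S.u' c) := by
  have h : LinearIndependent K (fun a => (S.ρEquiv c).symm (Pi.basisFun K (Fin (S.n c)) a)) :=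
    ((Pi.basisFun K (Fin (S.n c))).map (S.ρEquiv c).symm).linearIndependent
  have h2 := h.map' (S.U' c).subtype (Submodule.ker_subtype _)
  simp only [Pi.basisFun_apply] at h2
  exact h2

/-! ### The adapted vectors -/

/-- The vectors `x_c(s, a) = e_{s0} u_a`. [cite: Milne1999LefschetzClasses, §2] -/
def x (c : S.Colour) (s : Fin (S.d c.1)) (a : Fin (S.n c)) : V := S.e c s (S.z c) (S.u c a)

/-- The dual vectors `y_c(s, a) = f_{s0} u'_a` (pair colours). [cite: Milne1999LefschetzClasses, §2] -/
def y (c : S.Colour) (s : Fin (S.d c.1)) (a : Fin (S.n c)) : V := S.f c s (S.z c) (S.u' c a)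

/-- `x` lives in block `c.1`. [cite: Milne1999LefschetzClasses, §2] -/
theorem blockIdem_x (c : S.Colour) (s : Fin (S.d c.1)) (a : Fin (S.n c)) :
    blockIdem S.E S.ψ c.1 (S.x c s a) = S.x c s a := by
  unfold x; rw [← Module.End.mul_apply, S.blockIdem_mul_e]

/-- `y` lives in block `bar c.1`. [cite: Milne1999LefschetzClasses, §2] -/
theorem blockIdem_y (c : S.Colour) (s : Fin (S.d c.1)) (a : Fin (S.n c)) :
    blockIdem S.E S.ψ (S.bar c.1) (S.y c s a) = S.y c s a := by
  unfold y; rw [← Module.End.mul_apply, S.blockIdem_mul_f]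

/-- Action of the units on the `x`'s. [cite: Milne1999LefschetzClasses, §2] -/
theorem e_x (c : S.Colour) (a b s : Fin (S.d c.1)) (ℓ : Fin (S.n c)) :
    S.e c a b (S.x c s ℓ) = if b = s then S.x c a ℓ else 0 := by
  unfold x
  rw [← Module.End.mul_apply, S.e_mul_e]
  split_ifs <;> rfl

/-- Action of the transported units on the `y`'s. [cite: Milne1999LefschetzClasses, §2] -/
theorem f_y (c : S.Colour) (a b s : Fin (S.d c.1)) (ℓ : Fin (S.n c)) :
    S.f c a b (S.y c s ℓ) = if b = s then S.y c a ℓ else 0 := by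
  unfold y
  rw [← Module.End.mul_apply, S.f_mul_f]
  split_ifs <;> rfl

/-- For a pair colour the units kill the `y`'s. [cite: Milne1999LefschetzClasses, §2] -/
theorem e_y {c : S.Colour} (hc : ¬ S.IsForm c) (a b s : Fin (S.d c.1)) (ℓ : Fin (S.n c)) :
    S.e c a b (S.y c s ℓ) = 0 :=
  S.apply_eq_zero_of_blocks (fun h => hc h) (S.e_mul_blockIdem c a b) (S.blockIdem_y c s ℓ)

/-- For a pair colour the transported units kill the `x`'s. [cite: Milne1999LefschetzClasses, §2] -/
theorem f_x {c : S.Colour} (hc : ¬ S.IsForm c) (a b s : Fin (S.d c.1)) (ℓ : Fin (S.n c)) :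
    S.f c a b (S.x c s ℓ) = 0 :=
  S.apply_eq_zero_of_blocks (fun h => hc h.symm) (S.f_mul_blockIdem c a b) (S.blockIdem_x c s ℓ)

/-- Different colours have disjoint blocks. [cite: Milne1999LefschetzClasses, §2] -/
theorem blocks_ne {c c' : S.Colour} (h : c ≠ c') :
    c.1 ≠ c'.1 ∧ c.1 ≠ S.bar c'.1 ∧ S.bar c.1 ≠ c'.1 ∧ S.bar c.1 ≠ S.bar c'.1 := by
  have h1 : c.1 ≠ c'.1 := fun hh => h (Subtype.ext hh)
  have key : ∀ {c c' : S.Colour}, c.1 ≠ c'.1 → c.1 ≠ S.bar c'.1 := by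
    intro c c' hne hh
    have h2 : S.bar c.1 = c'.1 := by rw [hh, S.bar_bar]
    exact hne (le_antisymm (c.2.trans (le_of_eq h2)) (c'.2.trans (le_of_eq hh.symm)))
  refine ⟨h1, key h1, fun hh => key h1.symm hh.symm, fun hh => h1 ?_⟩
  rw [← S.bar_bar c.1, hh, S.bar_bar]

/-- For a pair colour the `x`'s are isotropic. [cite: Milne1999LefschetzClasses, §2] -/
theorem B_x_x_of_not_isForm {c : S.Colour} (hc : ¬ S.IsForm c) (s s' : Fin (S.d c.1))
    (a a' : Fin (S.n c)) : S.B (S.x c s a) (S.x c s' a') = 0 :=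
  S.form_eq_zero_of_blocks (i := c.1) (j := c.1) (fun h => hc (by unfold IsForm; rw [← h]))
    (S.blockIdem_x c s a) (S.blockIdem_x c s' a')

/-- For a pair colour the `y`'s are isotropic. [cite: Milne1999LefschetzClasses, §2] -/
theorem B_y_y_of_not_isForm {c : S.Colour} (hc : ¬ S.IsForm c) (s s' : Fin (S.d c.1))
    (a a' : Fin (S.n c)) : S.B (S.y c s a) (S.y c s' a') = 0 :=
  S.form_eq_zero_of_blocks (i := S.bar c.1) (j := S.bar c.1)
    (fun h => hc (by unfold IsForm; rw [S.bar_bar] at h; exact h))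
    (S.blockIdem_y c s a) (S.blockIdem_y c s' a')

/-- The pairing of `x`'s and `y`'s: `B (x(s,a)) (y(s',a')) = δ_{s s'} δ_{a a'}`.
[cite: Milne1999LefschetzClasses, §2] -/
theorem B_x_y (c : S.Colour) (s s' : Fin (S.d c.1)) (a a' : Fin (S.n c)) :
    S.B (S.x c s a) (S.y c s' a') = if s = s' ∧ a = a' then 1 else 0 := by
  unfold x y f
  rw [S.form_apply_right, ← Module.End.mul_apply, e, unit_mul_unit]
  by_cases h : s = s'
  · subst h
    rw [if_pos rfl]
    change S.B (S.e c (S.z c) (S.z c) (S.u c a)) (S.u' c a') = _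
    rw [S.e_apply_of_mem_U c (S.u_mem c a), S.B_u_u']
    by_cases ha : a = a'
    · rw [if_pos ha, if_pos ⟨rfl, ha⟩]
    · rw [if_neg ha, if_neg fun hh => ha hh.2]
  · rw [if_neg (Ne.symm h), LinearMap.zero_apply, LinearMap.BilinForm.zero_left, if_neg fun hh => h hh.1]

/-- The pairing of `y`'s and `x`'s. [cite: Milne1999LefschetzClasses, §2] -/
theorem B_y_x (c : S.Colour) (s s' : Fin (S.d c.1)) (a a' : Fin (S.n c)) :
    S.B (S.y c s' a') (S.x c s a) = -(if s = s' ∧ a = a' then 1 else 0) := by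
  rw [← S.hBa.neg_eq, S.B_x_y]

/-- `x`'s of different colours are orthogonal. [cite: Milne1999LefschetzClasses, §2] -/
theorem B_x_x_ne {c c' : S.Colour} (h : c ≠ c') (s : Fin (S.d c.1)) (s' : Fin (S.d c'.1))
    (a : Fin (S.n c)) (a' : Fin (S.n c')) : S.B (S.x c s a) (S.x c' s' a') = 0 :=
  S.form_eq_zero_of_blocks (S.blocks_ne h).2.2.1.symm (S.blockIdem_x c s a) (S.blockIdem_x c' s' a')

/-- `x`'s and `y`'s of different colours are orthogonal. [cite: Milne1999LefschetzClasses, §2] -/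
theorem B_x_y_ne {c c' : S.Colour} (h : c ≠ c') (s : Fin (S.d c.1)) (s' : Fin (S.d c'.1))
    (a : Fin (S.n c)) (a' : Fin (S.n c')) : S.B (S.x c s a) (S.y c' s' a') = 0 :=
  S.form_eq_zero_of_blocks (S.blocks_ne h).2.2.2.symm (S.blockIdem_x c s a) (S.blockIdem_y c' s' a')

/-- `y`'s and `x`'s of different colours are orthogonal. [cite: Milne1999LefschetzClasses, §2] -/
theorem B_y_x_ne {c c' : S.Colour} (h : c ≠ c') (s : Fin (S.d c.1)) (s' : Fin (S.d c'.1))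
    (a : Fin (S.n c)) (a' : Fin (S.n c')) : S.B (S.y c s a) (S.x c' s' a') = 0 :=
  S.form_eq_zero_of_blocks (by rw [S.bar_bar]; exact (S.blocks_ne h).1.symm)
    (S.blockIdem_y c s a) (S.blockIdem_x c' s' a')

/-- `y`'s of different colours are orthogonal. [cite: Milne1999LefschetzClasses, §2] -/
theorem B_y_y_ne {c c' : S.Colour} (h : c ≠ c') (s : Fin (S.d c.1)) (s' : Fin (S.d c'.1))
    (a : Fin (S.n c)) (a' : Fin (S.n c')) : S.B (S.y c s a) (S.y c' s' a') = 0 :=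
  S.form_eq_zero_of_blocks (by rw [S.bar_bar]; exact (S.blocks_ne h).2.1.symm)
    (S.blockIdem_y c s a) (S.blockIdem_y c' s' a')

/-- Units of one colour kill the `x`'s of another. [cite: Milne1999LefschetzClasses, §2] -/
theorem e_x_ne {c c' : S.Colour} (h : c ≠ c') (a b : Fin (S.d c.1)) (s : Fin (S.d c'.1))
    (ℓ : Fin (S.n c')) : S.e c a b (S.x c' s ℓ) = 0 :=
  S.apply_eq_zero_of_blocks (S.blocks_ne h).1.symm (S.e_mul_blockIdem c a b) (S.blockIdem_x c' s ℓ)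

/-- Units of one colour kill the `y`'s of another. [cite: Milne1999LefschetzClasses, §2] -/
theorem e_y_ne {c c' : S.Colour} (h : c ≠ c') (a b : Fin (S.d c.1)) (s : Fin (S.d c'.1))
    (ℓ : Fin (S.n c')) : S.e c a b (S.y c' s ℓ) = 0 :=
  S.apply_eq_zero_of_blocks (i := S.bar c'.1) (j := c.1) (S.blocks_ne h).2.1.symm
    (S.e_mul_blockIdem c a b) (S.blockIdem_y c' s ℓ)

/-- Transported units of one colour kill the `x`'s of another. [cite: Milne1999LefschetzClasses, §2] -/
theorem f_x_ne {c c' : S.Colour} (h : c ≠ c') (a b : Fin (S.d c.1)) (s : Fin (S.d c'.1))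
    (ℓ : Fin (S.n c')) : S.f c a b (S.x c' s ℓ) = 0 :=
  S.apply_eq_zero_of_blocks (i := c'.1) (j := S.bar c.1) (S.blocks_ne h).2.2.1.symm
    (S.f_mul_blockIdem c a b) (S.blockIdem_x c' s ℓ)

/-- Transported units of one colour kill the `y`'s of another. [cite: Milne1999LefschetzClasses, §2] -/
theorem f_y_ne {c c' : S.Colour} (h : c ≠ c') (a b : Fin (S.d c.1)) (s : Fin (S.d c'.1))
    (ℓ : Fin (S.n c')) : S.f c a b (S.y c' s ℓ) = 0 :=
  S.apply_eq_zero_of_blocks (S.blocks_ne h).2.2.2.symm (S.f_mul_blockIdem c a b) (S.blockIdem_y c' s ℓ)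

/-! ### The adapted basis -/

/-- Number of sides of a colour: `1` (form) or `2` (pair). [cite: Milne1999LefschetzClasses, §2] -/
def ns (c : S.Colour) : ℕ := if S.IsForm c then 1 else 2

/-- The index set of the adapted basis. [cite: Milne1999LefschetzClasses, §2] -/
def J : Type := Σ c : S.Colour, (Fin (S.d c.1) × Fin (S.n c)) × Fin (S.ns c)

/-- The index set is finite. [folklore] -/
instance : Fintype S.J := by unfold J; infer_instance

/-- The index set has decidable equality. [folklore] -/
instance : DecidableEq S.J := by unfold J; infer_instance

/-- The adapted vectors: `x` on side `0`, `y` on side `1`. [cite: Milne1999LefschetzClasses, §2] -/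
def vec (q : S.J) : V :=
  if (q.2.2 : ℕ) = 0 then S.x q.1 q.2.1.1 q.2.1.2 else S.y q.1 q.2.1.1 q.2.1.2

/-- A colour with a side `≠ 0` is a pair colour. [folklore] -/
private theorem not_isForm_of_side {c : S.Colour} (k : Fin (S.ns c)) (hk : (k : ℕ) ≠ 0) : ¬ S.IsForm c := by
  intro h
  have : S.ns c = 1 := if_pos h
  have := k.2
  omega

/-- Two non-zero sides coincide. [folklore] -/
private theorem side_eq_of_ne_zero {c : S.Colour} (k k' : Fin (S.ns c)) (hk : (k : ℕ) ≠ 0)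
    (hk' : (k' : ℕ) ≠ 0) : k = k' := by
  apply Fin.ext
  have h1 := k.2
  have h2 := k'.2
  have : S.ns c ≤ 2 := by unfold ns; split_ifs <;> omega
  omega

/-- A pair colour has the side `1`. [folklore] -/
def sideOne {c : S.Colour} (hc : ¬ S.IsForm c) : Fin (S.ns c) := ⟨1, by unfold ns; rw [if_neg hc]; omega⟩

/-- The side `0`. [folklore] -/
def sideZero (c : S.Colour) : Fin (S.ns c) := ⟨0, by unfold ns; split_ifs <;> omega⟩

/-- `vec` on side `0`. [folklore] -/
@[simp] private theorem vec_zero (c : S.Colour) (s : Fin (S.d c.1)) (a : Fin (S.n c)) :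
    S.vec ⟨c, (s, a), S.sideZero c⟩ = S.x c s a := by
  simp [vec, sideZero]

/-- `vec` on side `1`. [folklore] -/
@[simp] private theorem vec_one {c : S.Colour} (hc : ¬ S.IsForm c) (s : Fin (S.d c.1)) (a : Fin (S.n c)) :
    S.vec ⟨c, (s, a), S.sideOne hc⟩ = S.y c s a := by
  simp [vec, sideOne]

/-- Sums over a finite type supported on the image of an injection. [folklore] -/
private theorem sum_eq_sum_of_support {α β M : Type*} [Fintype α] [Fintype β] [DecidableEq β]
    [AddCommMonoid M] (ι : α → β) (hι : Function.Injective ι) (F : β → M)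
    (hF : ∀ q, (∀ a, q ≠ ι a) → F q = 0) : ∑ q, F q = ∑ a, F (ι a) := by
  rw [← Finset.sum_image (f := F) (s := Finset.univ) (g := ι) fun a _ b _ h => hι h]
  symm
  apply Finset.sum_subset (Finset.subset_univ _)
  intro q _ hq
  apply hF
  intro a ha
  apply hq
  exact Finset.mem_image.2 ⟨a, Finset.mem_univ _, ha.symm⟩

/-- The fibre embedding of the letters of a slot and side. [folklore] -/
def emb (c : S.Colour) (s : Fin (S.d c.1)) (k : Fin (S.ns c)) : Fin (S.n c) → S.J :=
  fun a => ⟨c, (s, a), k⟩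

/-- The fibre embedding is injective. [folklore] -/
private theorem emb_injective (c : S.Colour) (s : Fin (S.d c.1)) (k : Fin (S.ns c)) :
    Function.Injective (S.emb c s k) := by
  intro a a' h
  obtain ⟨-, h2⟩ := Sigma.mk.inj_iff.1 h
  have h3 := (Prod.mk.injEq _ _ _ _).mp (eq_of_heq h2)
  exact ((Prod.mk.injEq _ _ _ _).mp h3.1).2

/-- `e_{0s}` recovers the letter from the adapted vector of slot `s`, side `0`.
[cite: Milne1999LefschetzClasses, §2] -/
theorem e_vec_emb (c : S.Colour) (s : Fin (S.d c.1)) (a : Fin (S.n c)) :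
    S.e c (S.z c) s (S.vec (S.emb c s (S.sideZero c) a)) = S.u c a := by
  unfold emb
  rw [S.vec_zero, S.e_x, if_pos rfl]
  exact S.e_apply_of_mem_U c (S.u_mem c a)

/-- `e_{0s}` kills all other adapted vectors. [cite: Milne1999LefschetzClasses, §2] -/
theorem e_vec_eq_zero (c : S.Colour) (s : Fin (S.d c.1)) (q : S.J)
    (hq : ∀ a, q ≠ S.emb c s (S.sideZero c) a) : S.e c (S.z c) s (S.vec q) = 0 := by
  obtain ⟨c', ⟨s', a'⟩, k'⟩ := q
  unfold vec
  dsimp only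
  by_cases h : c' = c
  · subst h
    by_cases hk : (k' : ℕ) = 0
    · rw [if_pos hk, S.e_x]
      by_cases hs : s = s'
      · exfalso
        apply hq a'
        subst hs
        have hk1 : k' = S.sideZero c' := Fin.ext hk
        subst hk1
        rfl
      · rw [if_neg hs]
    · rw [if_neg hk]
      exact S.e_y (S.not_isForm_of_side k' hk) _ _ _ _
  · split_ifs
    · exact S.e_x_ne (Ne.symm h) _ _ _ _
    · exact S.e_y_ne (Ne.symm h) _ _ _ _

/-- `f_{0s}` recovers the dual letter from the adapted vector of slot `s`, side `1`.
[cite: Milne1999LefschetzClasses, §2] -/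
theorem f_vec_emb {c : S.Colour} (hc : ¬ S.IsForm c) (s : Fin (S.d c.1)) (a : Fin (S.n c)) :
    S.f c (S.z c) s (S.vec (S.emb c s (S.sideOne hc) a)) = S.u' c a := by
  unfold emb
  rw [S.vec_one hc, S.f_y, if_pos rfl]
  exact S.f_apply_of_mem_U' c (S.u'_mem c a)

/-- `f_{0s}` kills all other adapted vectors. [cite: Milne1999LefschetzClasses, §2] -/
theorem f_vec_eq_zero {c : S.Colour} (hc : ¬ S.IsForm c) (s : Fin (S.d c.1)) (q : S.J)
    (hq : ∀ a, q ≠ S.emb c s (S.sideOne hc) a) : S.f c (S.z c) s (S.vec q) = 0 := by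
  obtain ⟨c', ⟨s', a'⟩, k'⟩ := q
  unfold vec
  dsimp only
  by_cases h : c' = c
  · subst h
    by_cases hk : (k' : ℕ) = 0
    · rw [if_pos hk]
      exact S.f_x hc _ _ _ _
    · rw [if_neg hk, S.f_y]
      by_cases hs : s = s'
      · exfalso
        apply hq a'
        subst hs
        have hk1 : k' = S.sideOne hc := S.side_eq_of_ne_zero k' _ hk (by simp [sideOne])
        subst hk1
        rfl
      · rw [if_neg hs]
  · split_ifs
    · exact S.f_x_ne (Ne.symm h) _ _ _ _
    · exact S.f_y_ne (Ne.symm h) _ _ _ _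

/-- The adapted vectors are linearly independent. [cite: Milne1999LefschetzClasses, §2] -/
theorem linearIndependent_vec : LinearIndependent K S.vec := by
  classical
  rw [Fintype.linearIndependent_iff]
  intro g hg q
  obtain ⟨c, ⟨s, a⟩, k⟩ := q
  by_cases hk : (k : ℕ) = 0
  · have hk' : k = S.sideZero c := Fin.ext hk
    subst hk'
    have h1 := congrArg (S.e c (S.z c) s) hg
    rw [map_sum, map_zero] at h1
    simp_rw [map_smul] at h1
    rw [sum_eq_sum_of_support (S.emb c s (S.sideZero c)) (S.emb_injective _ _ _)
      (fun q => g q • S.e c (S.z c) s (S.vec q))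
      (fun q hq => by rw [S.e_vec_eq_zero c s q hq, smul_zero])] at h1
    simp_rw [S.e_vec_emb] at h1
    exact Fintype.linearIndependent_iff.1 (S.linearIndependent_u c) _ h1 a
  · have hc := S.not_isForm_of_side k hk
    have hk' : k = S.sideOne hc := S.side_eq_of_ne_zero k _ hk (by simp [sideOne])
    subst hk'
    have h1 := congrArg (S.f c (S.z c) s) hg
    rw [map_sum, map_zero] at h1
    simp_rw [map_smul] at h1
    rw [sum_eq_sum_of_support (S.emb c s (S.sideOne hc)) (S.emb_injective _ _ _)
      (fun q => g q • S.f c (S.z c) s (S.vec q))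
      (fun q hq => by rw [S.f_vec_eq_zero hc s q hq, smul_zero])] at h1
    simp_rw [S.f_vec_emb hc] at h1
    exact Fintype.linearIndependent_iff.1 (S.linearIndependent_u' c) _ h1 a

/-- The transported diagonal units sum to the partner block idempotent. [cite: Milne1999LefschetzClasses, §2] -/
theorem sum_f_diag (c : S.Colour) : ∑ s, S.f c s s = blockIdem S.E S.ψ (S.bar c.1) := by
  unfold f
  rw [← adj_sum, sum_unit_diag, S.adj_blockIdem]

/-- `x`'s are adapted vectors. [folklore] -/
private theorem x_mem_range_vec (c : S.Colour) (s : Fin (S.d c.1)) (a : Fin (S.n c)) :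
    S.x c s a ∈ Set.range S.vec :=
  ⟨⟨c, (s, a), S.sideZero c⟩, S.vec_zero c s a⟩

/-- `y`'s of pair colours are adapted vectors. [folklore] -/
private theorem y_mem_range_vec {c : S.Colour} (hc : ¬ S.IsForm c) (s : Fin (S.d c.1)) (a : Fin (S.n c)) :
    S.y c s a ∈ Set.range S.vec :=
  ⟨⟨c, (s, a), S.sideOne hc⟩, S.vec_one hc s a⟩

/-- The component of a vector in a representative block lies in the span of the `x`'s.
[cite: Milne1999LefschetzClasses, §2] -/
theorem blockIdem_apply_mem_span (c : S.Colour) (v : V) :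
    blockIdem S.E S.ψ c.1 v ∈ Submodule.span K (Set.range S.vec) := by
  rw [← sum_unit_diag, LinearMap.sum_apply]
  refine Submodule.sum_mem _ fun s _ => ?_
  have h1 : unit S.E S.ψ c.1 s s v = S.e c s (S.z c) (S.e c (S.z c) s v) := by
    rw [← Module.End.mul_apply, S.e_mul_e, if_pos rfl]; rfl
  have h2 : S.e c (S.z c) s v ∈ S.U c :=
    LinearMap.mem_range.2 ⟨S.e c (S.z c) s v, by rw [← Module.End.mul_apply, S.e_mul_e, if_pos rfl]⟩
  rw [← S.span_u c] at h2
  have h3 := Submodule.mem_map_of_mem (f := S.e c s (S.z c)) h2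
  rw [Submodule.map_span, ← Set.range_comp] at h3
  rw [h1]
  refine Submodule.span_mono ?_ h3
  rintro _ ⟨a, rfl⟩
  exact S.x_mem_range_vec c s a

/-- The component of a vector in a partner block lies in the span of the `y`'s.
[cite: Milne1999LefschetzClasses, §2] -/
theorem blockIdem_bar_apply_mem_span {c : S.Colour} (hc : ¬ S.IsForm c) (v : V) :
    blockIdem S.E S.ψ (S.bar c.1) v ∈ Submodule.span K (Set.range S.vec) := by
  rw [← S.sum_f_diag c, LinearMap.sum_apply]
  refine Submodule.sum_mem _ fun s _ => ?_
  have h1 : S.f c s s v = S.f c s (S.z c) (S.f c (S.z c) s v) := by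
    rw [← Module.End.mul_apply, S.f_mul_f, if_pos rfl]
  have h2 : S.f c (S.z c) s v ∈ S.U' c :=
    LinearMap.mem_range.2 ⟨S.f c (S.z c) s v, by rw [← Module.End.mul_apply, S.f_mul_f, if_pos rfl]⟩
  rw [← S.span_u' c] at h2
  have h3 := Submodule.mem_map_of_mem (f := S.f c s (S.z c)) h2
  rw [Submodule.map_span, ← Set.range_comp] at h3
  rw [h1]
  refine Submodule.span_mono ?_ h3
  rintro _ ⟨a, rfl⟩
  exact S.y_mem_range_vec hc s a

/-- Every block is a representative block or the partner of one. [cite: Milne1999LefschetzClasses, §2] -/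
theorem exists_colour (i : Fin S.t) :
    ∃ c : S.Colour, i = c.1 ∨ (¬ S.IsForm c ∧ i = S.bar c.1) := by
  by_cases hi : i ≤ S.bar i
  · exact ⟨⟨i, hi⟩, Or.inl rfl⟩
  · have hlt : S.bar i < i := not_le.1 hi
    refine ⟨⟨S.bar i, by rw [S.bar_bar]; exact hlt.le⟩, Or.inr ⟨?_, by rw [S.bar_bar]⟩⟩
    unfold IsForm
    dsimp only
    rw [S.bar_bar]
    exact fun h => hlt.ne' h

/-- The adapted vectors span `V`. [cite: Milne1999LefschetzClasses, §2] -/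
theorem span_vec : ⊤ ≤ Submodule.span K (Set.range S.vec) := by
  intro v _
  have hv : v = ∑ i, blockIdem S.E S.ψ i v := by
    rw [← LinearMap.sum_apply, sum_blockIdem]; rfl
  rw [hv]
  refine Submodule.sum_mem _ fun i _ => ?_
  obtain ⟨c, h | ⟨hc, h⟩⟩ := S.exists_colour i
  · rw [h]; exact S.blockIdem_apply_mem_span c v
  · rw [h]; exact S.blockIdem_bar_apply_mem_span hc v

/-- The adapted basis indexed by `J`. [cite: Milne1999LefschetzClasses, §2] -/
def basisJ : Module.Basis S.J K V := Module.Basis.mk S.linearIndependent_vec S.span_vec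

/-- Its vectors. [folklore] -/
@[simp] private theorem basisJ_apply (q : S.J) : S.basisJ q = S.vec q := Module.Basis.mk_apply _ _ q

/-- The number of letters. [cite: Milne1999LefschetzClasses, §2] -/
def N : ℕ := Fintype.card S.J

/-- The numbering of the letters. [folklore] -/
def eJ : S.J ≃ Fin S.N := Fintype.equivFin S.J

/-- The adapted basis indexed by `Fin N`. [cite: Milne1999LefschetzClasses, §2] -/
def β : Module.Basis (Fin S.N) K V := S.basisJ.reindex S.eJ

/-- Its vectors. [folklore] -/
private theorem β_apply (j : Fin S.N) : S.β j = S.vec (S.eJ.symm j) := by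
  rw [β, Module.Basis.reindex_apply, basisJ_apply]

/-- Its vectors, from `J`. [folklore] -/
@[simp] private theorem β_eJ (q : S.J) : S.β (S.eJ q) = S.vec q := by
  rw [β_apply, Equiv.symm_apply_apply]

/-! ### `B` on adapted vectors of different colours; fibrewise operators -/

/-- Adapted vectors of different colours are orthogonal. [cite: Milne1999LefschetzClasses, §2] -/
theorem B_vec_vec_ne (q q' : S.J) (h : q.1 ≠ q'.1) : S.B (S.vec q) (S.vec q') = 0 := by
  obtain ⟨c, ⟨s, a⟩, k⟩ := q
  obtain ⟨c', ⟨s', a'⟩, k'⟩ := q'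
  unfold vec
  dsimp only at h ⊢
  split_ifs
  · exact S.B_x_x_ne h s s' a a'
  · exact S.B_x_y_ne h s s' a a'
  · exact S.B_y_x_ne h s s' a a'
  · exact S.B_y_y_ne h s s' a a'

/-- A combination of the fibre of `(c, s, k)` is orthogonal to adapted vectors of other colours (right).
[cite: Milne1999LefschetzClasses, §2] -/
theorem B_vec_sum_ne (q : S.J) (c : S.Colour) (h : q.1 ≠ c) (s : Fin (S.d c.1)) (k : Fin (S.ns c))
    (γ : Fin (S.n c) → K) : S.B (S.vec q) (∑ a, γ a • S.vec ⟨c, (s, a), k⟩) = 0 := by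
  rw [map_sum]
  refine Finset.sum_eq_zero fun a _ => ?_
  rw [LinearMap.BilinForm.smul_right, S.B_vec_vec_ne q ⟨c, (s, a), k⟩ h, mul_zero]

/-- A combination of the fibre of `(c, s, k)` is orthogonal to adapted vectors of other colours (left).
[cite: Milne1999LefschetzClasses, §2] -/
theorem B_sum_vec_ne (q : S.J) (c : S.Colour) (h : q.1 ≠ c) (s : Fin (S.d c.1)) (k : Fin (S.ns c))
    (γ : Fin (S.n c) → K) : S.B (∑ a, γ a • S.vec ⟨c, (s, a), k⟩) (S.vec q) = 0 := by
  rw [← S.hBa.neg_eq, S.B_vec_sum_ne q c h, neg_zero]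

/-- **Fibrewise commutation.** An operator `u` acting on each fibre `{vec(c, s, ·, k)}` by a matrix depending
only on `(c, k)` commutes with every operator mapping whole fibres to whole fibres letterwise (or to `0`).
[cite: Milne1999LefschetzClasses, §2] -/
theorem commute_of_fibrewise (u X : Module.End K V)
    (hu : ∀ (c : S.Colour) (k : Fin (S.ns c)), ∃ γ : Matrix (Fin (S.n c)) (Fin (S.n c)) K,
      ∀ s ℓ, u (S.vec ⟨c, (s, ℓ), k⟩) = ∑ ℓ', γ ℓ' ℓ • S.vec ⟨c, (s, ℓ'), k⟩)
    (hX : ∀ (c : S.Colour) (s : Fin (S.d c.1)) (k : Fin (S.ns c)),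
      (∀ ℓ, X (S.vec ⟨c, (s, ℓ), k⟩) = 0) ∨ ∃ s', ∀ ℓ, X (S.vec ⟨c, (s, ℓ), k⟩) = S.vec ⟨c, (s', ℓ), k⟩) :
    X * u = u * X := by
  refine S.basisJ.ext fun q => ?_
  obtain ⟨c, ⟨s, ℓ⟩, k⟩ := q
  rw [basisJ_apply, Module.End.mul_apply, Module.End.mul_apply]
  obtain ⟨γ, hγ⟩ := hu c k
  rcases hX c s k with h0 | ⟨s', hs'⟩
  · rw [h0, map_zero, hγ, map_sum]
    simp_rw [map_smul, h0, smul_zero, Finset.sum_const_zero]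
  · rw [hs', hγ, hγ, map_sum]
    simp_rw [map_smul, hs']

/-- The units map fibres to fibres. [cite: Milne1999LefschetzClasses, §2] -/
theorem e_fibrewise (c₀ : S.Colour) (a b : Fin (S.d c₀.1)) (c : S.Colour) (s : Fin (S.d c.1))
    (k : Fin (S.ns c)) :
    (∀ ℓ, S.e c₀ a b (S.vec ⟨c, (s, ℓ), k⟩) = 0) ∨
      ∃ s', ∀ ℓ, S.e c₀ a b (S.vec ⟨c, (s, ℓ), k⟩) = S.vec ⟨c, (s', ℓ), k⟩ := by
  by_cases h : c = c₀
  · subst h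
    by_cases hk : (k : ℕ) = 0
    · have hk' : k = S.sideZero c := Fin.ext hk
      subst hk'
      by_cases hb : b = s
      · right
        refine ⟨a, fun ℓ => ?_⟩
        rw [S.vec_zero, S.vec_zero, S.e_x, if_pos hb]
      · left
        intro ℓ
        rw [S.vec_zero, S.e_x, if_neg hb]
    · left
      intro ℓ
      have hc := S.not_isForm_of_side k hk
      have hk' : k = S.sideOne hc := S.side_eq_of_ne_zero k _ hk (by simp [sideOne])
      subst hk'
      rw [S.vec_one hc, S.e_y hc]
  · left
    intro ℓ
    unfold vec
    dsimp only
    split_ifs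
    · exact S.e_x_ne (Ne.symm h) _ _ _ _
    · exact S.e_y_ne (Ne.symm h) _ _ _ _

/-- The transported units map fibres to fibres. [cite: Milne1999LefschetzClasses, §2] -/
theorem f_fibrewise {c₀ : S.Colour} (hc₀ : ¬ S.IsForm c₀) (a b : Fin (S.d c₀.1)) (c : S.Colour)
    (s : Fin (S.d c.1)) (k : Fin (S.ns c)) :
    (∀ ℓ, S.f c₀ a b (S.vec ⟨c, (s, ℓ), k⟩) = 0) ∨
      ∃ s', ∀ ℓ, S.f c₀ a b (S.vec ⟨c, (s, ℓ), k⟩) = S.vec ⟨c, (s', ℓ), k⟩ := by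
  by_cases h : c = c₀
  · subst h
    by_cases hk : (k : ℕ) = 0
    · have hk' : k = S.sideZero c := Fin.ext hk
      subst hk'
      left
      intro ℓ
      rw [S.vec_zero, S.f_x hc₀]
    · have hk' : k = S.sideOne hc₀ := S.side_eq_of_ne_zero k _ hk (by simp [sideOne])
      subst hk'
      by_cases hb : b = s
      · right
        refine ⟨a, fun ℓ => ?_⟩
        rw [S.vec_one hc₀, S.vec_one hc₀, S.f_y, if_pos hb]
      · left
        intro ℓ
        rw [S.vec_one hc₀, S.f_y, if_neg hb]
  · left
    intro ℓ
    unfold vec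
    dsimp only
    split_ifs
    · exact S.f_x_ne (Ne.symm h) _ _ _ _
    · exact S.f_y_ne (Ne.symm h) _ _ _ _

/-- The component of `X ∈ E` in a partner block is a combination of transported units.
[cite: Milne1999LefschetzClasses, §2] -/
theorem blockIdem_bar_mul_mul_eq_sum (c : S.Colour) {X : Module.End K V} (hX : X ∈ S.E) :
    blockIdem S.E S.ψ (S.bar c.1) * X * blockIdem S.E S.ψ (S.bar c.1) =
      ∑ a, ∑ b, S.ψ ⟨adj S.B S.hB X, S.hE X hX⟩ c.1 a b • S.f c b a := by
  have h1 : blockIdem S.E S.ψ (S.bar c.1) * X * blockIdem S.E S.ψ (S.bar c.1) =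
      adj S.B S.hB (blockIdem S.E S.ψ c.1 * adj S.B S.hB X * blockIdem S.E S.ψ c.1) := by
    rw [adj_mul, adj_mul, adj_adj_of_isAlt S.B S.hB S.hBa, S.adj_blockIdem, mul_assoc]
  rw [h1, blockIdem_mul_mul_blockIdem_eq_sum S.E S.ψ (S.hE X hX) c.1, adj_sum]
  refine Finset.sum_congr rfl fun a _ => ?_
  rw [adj_sum]
  refine Finset.sum_congr rfl fun b _ => ?_
  rw [adj_smul]
  rfl

/-- An operator commuting with all units `e` and, for pair colours, all transported units `f`, commutes
with `E`. [cite: Milne1999LefschetzClasses, §2] -/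
theorem commute_of_units (u : Module.End K V) (h1 : ∀ (c : S.Colour) a b, S.e c a b * u = u * S.e c a b)
    (h2 : ∀ (c : S.Colour), ¬ S.IsForm c → ∀ a b, S.f c a b * u = u * S.f c a b) :
    ∀ X ∈ S.E, X * u = u * X := by
  intro X hX
  rw [eq_sum_blockIdem_mul_mul_blockIdem S.E S.ψ hX, Finset.sum_mul, Finset.mul_sum]
  refine Finset.sum_congr rfl fun i _ => ?_
  obtain ⟨c, h | ⟨hc, h⟩⟩ := S.exists_colour i
  · rw [h, blockIdem_mul_mul_blockIdem_eq_sum S.E S.ψ hX c.1, Finset.sum_mul, Finset.mul_sum]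
    refine Finset.sum_congr rfl fun a _ => ?_
    rw [Finset.sum_mul, Finset.mul_sum]
    refine Finset.sum_congr rfl fun b _ => ?_
    rw [smul_mul_assoc, mul_smul_comm]
    exact congrArg _ (h1 c a b)
  · rw [h, S.blockIdem_bar_mul_mul_eq_sum c hX, Finset.sum_mul, Finset.mul_sum]
    refine Finset.sum_congr rfl fun a _ => ?_
    rw [Finset.sum_mul, Finset.mul_sum]
    refine Finset.sum_congr rfl fun b _ => ?_
    rw [smul_mul_assoc, mul_smul_comm]
    exact congrArg _ (h2 c hc b a)

/-- Bilinear expansion of `B` on two finite combinations. [folklore] -/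
private theorem B_sum_smul_sum_smul {ι₁ ι₂ : Type*} [Fintype ι₁] [Fintype ι₂] (α : ι₁ → K) (v : ι₁ → V)
    (γ : ι₂ → K) (w : ι₂ → V) :
    S.B (∑ a, α a • v a) (∑ a', γ a' • w a') = ∑ a, ∑ a', α a * γ a' * S.B (v a) (w a') := by
  rw [LinearMap.BilinForm.sum_left]
  refine Finset.sum_congr rfl fun a _ => ?_
  rw [LinearMap.BilinForm.smul_left, LinearMap.BilinForm.sum_right, Finset.mul_sum]
  refine Finset.sum_congr rfl fun a' _ => ?_
  rw [LinearMap.BilinForm.smul_right, mul_assoc]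

/-! ### Form colours: the Gram factorisation `φ ⊗ Ω` -/

section Form

variable (c : S.Colour) (hc : S.IsForm c)

/-- The transported system of a self-dual block, as a second system of matrix units of the same block.
[cite: Milne1999LefschetzClasses, §2] -/
def Tsys : BlockSys S.E (blockIdem S.E S.ψ c.1) :=
  (wedderburnSys S.E S.ψ c.1).transpose S.B S.hB S.hBa S.hE (blockIdem S.E S.ψ c.1)
    (by rw [S.adj_blockIdem, hc])

/-- The line generator `κ` of the corner `f₀₀ E e₀₀`. [cite: Milne1999LefschetzClasses, §2] -/
def κ : Module.End K V := Classical.choose (exists_smul_eq_sandwich S.E S.ψ c.1 (S.Tsys c hc) rfl)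

/-- Defining property of `κ`. [cite: Milne1999LefschetzClasses, §2] -/
theorem κ_spec :
    (∃ X₀ ∈ S.E, S.κ c hc = S.f c (S.z c) (S.z c) * X₀ * S.e c (S.z c) (S.z c)) ∧
      ∀ X ∈ S.E, ∃ r : K, S.f c (S.z c) (S.z c) * X * S.e c (S.z c) (S.z c) = r • S.κ c hc :=
  Classical.choose_spec (exists_smul_eq_sandwich S.E S.ψ c.1 (S.Tsys c hc) rfl)

/-- The slot matrix `φ`: `f_{0s} e_{s'0} = φ_{s s'} κ`. [cite: Milne1999LefschetzClasses, §2] -/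
def φ (s s' : Fin (S.d c.1)) : K :=
  Classical.choose ((S.κ_spec c hc).2 (S.f c (S.z c) s * S.e c s' (S.z c))
    (S.E.mul_mem (S.f_mem c _ _) (S.e_mem c _ _)))

/-- Defining property of `φ`. [cite: Milne1999LefschetzClasses, §2] -/
theorem f_mul_e_eq (s s' : Fin (S.d c.1)) : S.f c (S.z c) s * S.e c s' (S.z c) = S.φ c hc s s' • S.κ c hc := by
  have h := Classical.choose_spec ((S.κ_spec c hc).2 (S.f c (S.z c) s * S.e c s' (S.z c))
    (S.E.mul_mem (S.f_mem c _ _) (S.e_mem c _ _)))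
  have h2 : S.f c (S.z c) (S.z c) * (S.f c (S.z c) s * S.e c s' (S.z c)) * S.e c (S.z c) (S.z c) =
      S.f c (S.z c) s * S.e c s' (S.z c) := by
    rw [← mul_assoc, S.f_mul_f, if_pos rfl, mul_assoc, S.e_mul_e, if_pos rfl]
  rw [← h2]
  exact h

/-- The letter form `Ω_{a a'} = B (u_a) (κ u_{a'})`. [cite: Milne1999LefschetzClasses, §2] -/
def Ω : Matrix (Fin (S.n c)) (Fin (S.n c)) K := fun a a' => S.B (S.u c a) (S.κ c hc (S.u c a'))

/-- **Gram factorisation** on a form colour: `B (x(s,a)) (x(s',a')) = φ_{s s'} Ω_{a a'}`.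
[cite: Milne1999LefschetzClasses, §2] -/
theorem B_x_x (s s' : Fin (S.d c.1)) (a a' : Fin (S.n c)) :
    S.B (S.x c s a) (S.x c s' a') = S.φ c hc s s' * S.Ω c hc a a' := by
  unfold x
  rw [S.form_apply_left, ← Module.End.mul_apply]
  change S.B (S.u c a) ((S.f c (S.z c) s * S.e c s' (S.z c)) (S.u c a')) = _
  rw [S.f_mul_e_eq c hc, LinearMap.smul_apply, LinearMap.BilinForm.smul_right]
  rfl

/-- `κ† = η κ` for a scalar `η`. [cite: Milne1999LefschetzClasses, §2] -/
theorem exists_adj_κ : ∃ η : K, adj S.B S.hB (S.κ c hc) = η • S.κ c hc := by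
  obtain ⟨X₀, hX₀, hκ⟩ := (S.κ_spec c hc).1
  obtain ⟨r, hr⟩ := (S.κ_spec c hc).2 (adj S.B S.hB X₀) (S.hE _ hX₀)
  refine ⟨r, ?_⟩
  rw [← hr, hκ, adj_mul, adj_mul]
  unfold f
  rw [adj_adj_of_isAlt S.B S.hB S.hBa, mul_assoc]
  rfl

/-- `Ω` is `ε`-symmetric with `ε = ±1`. [cite: Milne1999LefschetzClasses, §2] -/
theorem Ω_transpose : ∃ ε : K, (ε = 1 ∨ ε = -1) ∧ ∀ a a', S.Ω c hc a' a = ε * S.Ω c hc a a' := by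
  obtain ⟨η, hη⟩ := S.exists_adj_κ c hc
  by_cases hκ0 : S.κ c hc = 0
  · refine ⟨1, Or.inl rfl, fun a a' => ?_⟩
    simp [Ω, hκ0]
  · have hη2 : η * η = 1 := by
      have h1 : S.κ c hc = (η * η) • S.κ c hc := by
        conv_lhs => rw [← adj_adj_of_isAlt S.B S.hB S.hBa (S.κ c hc), hη, adj_smul, hη, smul_smul]
      by_contra hne
      apply hκ0
      have h2 : (η * η - 1) • S.κ c hc = 0 := by rw [sub_smul, one_smul, ← h1, sub_self]
      exact (smul_eq_zero.1 h2).resolve_left (sub_ne_zero.2 hne)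
    refine ⟨-η, ?_, fun a a' => ?_⟩
    · rcases mul_self_eq_one_iff.1 hη2 with h | h
      · right; rw [h]
      · left; rw [h, neg_neg]
    · unfold Ω
      rw [← adj_spec S.B S.hB (S.κ c hc), hη, LinearMap.smul_apply, LinearMap.BilinForm.smul_left,
        ← S.hBa.neg_eq]
      ring

end Form

/-- The adapted vectors of one fibre are linearly independent. [folklore] -/
private theorem linearIndependent_fibre (c : S.Colour) (s : Fin (S.d c.1)) (k : Fin (S.ns c)) :
    LinearIndependent K (fun a => S.vec ⟨c, (s, a), k⟩) :=
  S.linearIndependent_vec.comp (S.emb c s k) (S.emb_injective c s k)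

/-- A vector orthogonal to all adapted vectors vanishes. [folklore] -/
private theorem eq_zero_of_forall_B_vec {w : V} (h : ∀ q : S.J, S.B (S.vec q) w = 0) : w = 0 := by
  refine S.hB.2 w fun v => ?_
  have h1 : S.B.flip w = 0 := S.basisJ.ext fun q => by
    rw [basisJ_apply, LinearMap.BilinForm.flip_apply, LinearMap.zero_apply]; exact h q
  have h2 := LinearMap.congr_fun h1 v
  rwa [LinearMap.BilinForm.flip_apply, LinearMap.zero_apply] at h2

/-- On a form colour all sides are `0`. [folklore] -/
private theorem side_eq_sideZero {c : S.Colour} (hc : S.IsForm c) (k : Fin (S.ns c)) : k = S.sideZero c := by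
  apply Fin.ext
  have h := k.2
  simp only [ns, if_pos hc] at h
  change (k : ℕ) = 0
  omega

section Form

variable (c : S.Colour) (hc : S.IsForm c)

/-- `Ω` has trivial kernel. [cite: Milne1999LefschetzClasses, §2] -/
theorem Ω_mulVec_injective : Function.Injective (S.Ω c hc).mulVec := by
  suffices hk : ∀ w, (S.Ω c hc).mulVec w = 0 → w = 0 by
    intro w w' h
    rw [← sub_eq_zero]
    apply hk
    rw [Matrix.mulVec_sub, h, sub_self]
  intro w hw
  have hW : ∀ q : S.J, S.B (S.vec q) (∑ a', w a' • S.vec ⟨c, (S.z c, a'), S.sideZero c⟩) = 0 := by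
    intro q
    by_cases hq : q.1 = c
    · obtain ⟨c', ⟨b, ℓ⟩, k⟩ := q
      dsimp only at hq
      subst hq
      have hk := S.side_eq_sideZero hc k
      subst hk
      simp only [S.vec_zero, map_sum, LinearMap.BilinForm.smul_right, S.B_x_x c' hc]
      have h1 : ∑ a', w a' * (S.φ c' hc b (S.z c') * S.Ω c' hc ℓ a') =
          S.φ c' hc b (S.z c') * (S.Ω c' hc).mulVec w ℓ := by
        simp only [Matrix.mulVec, dotProduct, Finset.mul_sum]
        exact Finset.sum_congr rfl fun a' _ => by ring
      rw [h1, hw, Pi.zero_apply, mul_zero]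
    · exact S.B_vec_sum_ne _ c hq (S.z c) (S.sideZero c) w
  have hW0 := S.eq_zero_of_forall_B_vec hW
  exact funext (Fintype.linearIndependent_iff.1 (S.linearIndependent_fibre c (S.z c) (S.sideZero c)) w hW0)

/-- `Ω` is invertible. [cite: Milne1999LefschetzClasses, §2] -/
theorem isUnit_Ω : IsUnit (S.Ω c hc) :=
  Matrix.mulVec_injective_iff_isUnit.1 (S.Ω_mulVec_injective c hc)

/-- `Ω` is non-degenerate. [cite: Milne1999LefschetzClasses, §2] -/
theorem Ω_nondegenerate : (Matrix.toBilin' (S.Ω c hc)).Nondegenerate := by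
  rw [LinearMap.BilinForm.nondegenerate_toBilin'_iff_det_ne_zero]
  exact ((Matrix.isUnit_iff_isUnit_det _).1 (S.isUnit_Ω c hc)).ne_zero

/-- `Ω` is alternating or symmetric (types Sp / O of [Milne 1999, §2]). [cite: Milne1999LefschetzClasses, §2] -/
theorem Ω_isAlt_or_isSymm [CharZero K] :
    (Matrix.toBilin' (S.Ω c hc)).IsAlt ∨ (Matrix.toBilin' (S.Ω c hc)).IsSymm := by
  obtain ⟨ε, hε, hT⟩ := S.Ω_transpose c hc
  rcases hε with rfl | rfl
  · right
    refine LinearMap.BilinForm.isSymm_def.2 fun v w => ?_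
    rw [Matrix.toBilin'_apply, Matrix.toBilin'_apply, Finset.sum_comm]
    refine Finset.sum_congr rfl fun i _ => Finset.sum_congr rfl fun j _ => ?_
    rw [hT i j, one_mul]
    ring
  · left
    intro v
    have h : Matrix.toBilin' (S.Ω c hc) v v = -Matrix.toBilin' (S.Ω c hc) v v := by
      conv_rhs => rw [Matrix.toBilin'_apply, Finset.sum_comm]
      rw [Matrix.toBilin'_apply, ← Finset.sum_neg_distrib]
      refine Finset.sum_congr rfl fun i _ => ?_
      rw [← Finset.sum_neg_distrib]
      refine Finset.sum_congr rfl fun j _ => ?_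
      rw [hT i j]
      ring
    have h2 : (2 : K) * Matrix.toBilin' (S.Ω c hc) v v = 0 := by rw [two_mul]; nth_rw 2 [h]; rw [add_neg_cancel]
    exact (mul_eq_zero.1 h2).resolve_left two_ne_zero

/-- **Form-colour kernels** (Milne's degree-2 invariant `φ_σ` between two copies of `U_σ`): the contraction
operator of `Ω⁻¹` placed on slots `(s, s')` is `Σ_b (ε φ_{b s'} e_{s b} − φ_{b s} e_{s' b}) ∈ E`.
[cite: Milne1999LefschetzClasses, §3 p. 654 and Prop. 3.6] -/
theorem form_kernel (s s' : Fin (S.d c.1)) : ∃ X ∈ S.E, ∀ v,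
    X v = ∑ a, ∑ a', (S.Ω c hc)⁻¹ a a' •
      (S.B v (S.x c s' a') • S.x c s a - S.B v (S.x c s a) • S.x c s' a') := by
  obtain ⟨ε, -, hT⟩ := S.Ω_transpose c hc
  have hdet : IsUnit (S.Ω c hc).det := (Matrix.isUnit_iff_isUnit_det _).1 (S.isUnit_Ω c hc)
  have hinv1 : ∀ a ℓ, ∑ a', (S.Ω c hc)⁻¹ a a' * S.Ω c hc ℓ a' = ε * (if a = ℓ then 1 else 0) := by
    intro a ℓ
    have h := congrFun (congrFun (Matrix.nonsing_inv_mul (S.Ω c hc) hdet) a) ℓ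
    rw [Matrix.mul_apply, Matrix.one_apply] at h
    rw [← h, Finset.mul_sum]
    refine Finset.sum_congr rfl fun a' _ => ?_
    rw [hT a' ℓ]
    ring
  have hinv2 : ∀ a' ℓ, ∑ a, (S.Ω c hc)⁻¹ a a' * S.Ω c hc ℓ a = if ℓ = a' then 1 else 0 := by
    intro a' ℓ
    have h := congrFun (congrFun (Matrix.mul_nonsing_inv (S.Ω c hc) hdet) ℓ) a'
    rw [Matrix.mul_apply, Matrix.one_apply] at h
    rw [← h]
    exact Finset.sum_congr rfl fun a _ => mul_comm _ _
  refine ⟨∑ b, (ε * S.φ c hc b s') • S.e c s b - ∑ b, S.φ c hc b s • S.e c s' b,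
    S.E.sub_mem (S.E.sum_mem fun b _ => S.E.smul_mem (S.e_mem c s b) _)
      (S.E.sum_mem fun b _ => S.E.smul_mem (S.e_mem c s' b) _), ?_⟩
  let T : Module.End K V := ∑ a, ∑ a', (S.Ω c hc)⁻¹ a a' •
    ((S.B.flip (S.x c s' a')).smulRight (S.x c s a) - (S.B.flip (S.x c s a)).smulRight (S.x c s' a'))
  have hT' : ∀ v, T v = ∑ a, ∑ a', (S.Ω c hc)⁻¹ a a' •
      (S.B v (S.x c s' a') • S.x c s a - S.B v (S.x c s a) • S.x c s' a') := by
    intro v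
    simp only [T, LinearMap.sum_apply, LinearMap.smul_apply, LinearMap.sub_apply,
      LinearMap.smulRight_apply, LinearMap.BilinForm.flip_apply]
  suffices h : (∑ b, (ε * S.φ c hc b s') • S.e c s b - ∑ b, S.φ c hc b s • S.e c s' b) = T by
    intro v; rw [h, hT']
  refine S.basisJ.ext fun q => ?_
  rw [basisJ_apply, hT']
  by_cases hq : q.1 = c
  · obtain ⟨c', ⟨b, ℓ⟩, k⟩ := q
    dsimp only at hq
    subst hq
    have hk := S.side_eq_sideZero hc k
    subst hk
    rw [S.vec_zero]
    -- left-hand side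
    rw [LinearMap.sub_apply, LinearMap.sum_apply, LinearMap.sum_apply]
    simp_rw [LinearMap.smul_apply, S.e_x, smul_ite, smul_zero, Finset.sum_ite_eq', Finset.mem_univ, if_true]
    -- right-hand side
    simp_rw [S.B_x_x c' hc, smul_sub, Finset.sum_sub_distrib, smul_smul]
    rw [Finset.sum_comm (f := fun a a' => ((S.Ω c' hc)⁻¹ a a' * (S.φ c' hc b s * S.Ω c' hc ℓ a)) •
      S.x c' s' a')]
    simp_rw [← Finset.sum_smul]
    have e1 : ∀ a, ∑ a', (S.Ω c' hc)⁻¹ a a' * (S.φ c' hc b s' * S.Ω c' hc ℓ a') =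
        ε * S.φ c' hc b s' * (if a = ℓ then 1 else 0) := by
      intro a
      rw [show ∑ a', (S.Ω c' hc)⁻¹ a a' * (S.φ c' hc b s' * S.Ω c' hc ℓ a') =
        S.φ c' hc b s' * ∑ a', (S.Ω c' hc)⁻¹ a a' * S.Ω c' hc ℓ a' by
          rw [Finset.mul_sum]; exact Finset.sum_congr rfl fun a' _ => by ring, hinv1]
      ring
    have e2 : ∀ a', ∑ a, (S.Ω c' hc)⁻¹ a a' * (S.φ c' hc b s * S.Ω c' hc ℓ a) =
        S.φ c' hc b s * (if ℓ = a' then 1 else 0) := by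
      intro a'
      rw [show ∑ a, (S.Ω c' hc)⁻¹ a a' * (S.φ c' hc b s * S.Ω c' hc ℓ a) =
        S.φ c' hc b s * ∑ a, (S.Ω c' hc)⁻¹ a a' * S.Ω c' hc ℓ a by
          rw [Finset.mul_sum]; exact Finset.sum_congr rfl fun a _ => by ring, hinv2]
    simp_rw [e1, e2, mul_ite, mul_one, mul_zero, ite_smul, zero_smul, Finset.sum_ite_eq,
      Finset.sum_ite_eq', Finset.mem_univ, if_true]
  · -- other colours: both sides vanish
    have h0 : ∀ (t : Fin (S.d c.1)) (a : Fin (S.n c)), S.B (S.vec q) (S.x c t a) = 0 := by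
      intro t a
      rw [← S.vec_zero]
      exact S.B_vec_vec_ne q _ hq
    simp_rw [h0, zero_smul, sub_zero, smul_zero, Finset.sum_const_zero]
    rw [LinearMap.sub_apply, LinearMap.sum_apply, LinearMap.sum_apply]
    have h1 : ∀ (t t' : Fin (S.d c.1)), S.e c t t' (S.vec q) = 0 := by
      intro t t'
      obtain ⟨c', ⟨b, ℓ⟩, k⟩ := q
      rcases S.e_fibrewise c t t' c' b k with h | ⟨s'', hs''⟩
      · exact h ℓ
      · exfalso
        -- a shifted fibre would be in colour c' ≠ c yet image of a unit of colour c: units of c kill c' ≠ c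
        have := hs'' ℓ
        unfold vec at this
        dsimp only at hq this
        split_ifs at this with hk
        · rw [S.e_x_ne (Ne.symm hq)] at this
          exact (S.linearIndependent_vec.ne_zero ⟨c', (s'', ℓ), k⟩) (by rw [vec, if_pos hk]; exact this.symm)
        · rw [S.e_y_ne (Ne.symm hq)] at this
          exact (S.linearIndependent_vec.ne_zero ⟨c', (s'', ℓ), k⟩) (by rw [vec, if_neg hk]; exact this.symm)
    simp_rw [LinearMap.smul_apply, h1, smul_zero, Finset.sum_const_zero, sub_zero]

/-- **Form-colour group elements**: an operator acting by `g` (`gᵀ Ω g = Ω`) on the letters of each slot of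
colour `c` and trivially elsewhere is an `E`-linear `B`-isometry (`1 ⊗ g ∈ Sp/O` of [Milne 1999, §2]).
[cite: Milne1999LefschetzClasses, §2 pp. 648–650 and Prop. 3.6] -/
theorem form_group (g : Matrix (Fin (S.n c)) (Fin (S.n c)) K) (hg : gᵀ * S.Ω c hc * g = S.Ω c hc)
    (u : Module.End K V) (hu1 : ∀ s a, u (S.x c s a) = ∑ a', g a' a • S.x c s a')
    (hu2 : ∀ q : S.J, q.1 ≠ c → u (S.vec q) = S.vec q) :
    (∀ X ∈ S.E, X * u = u * X) ∧ ∀ v w, S.B (u v) (u w) = S.B v w := by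
  have hu : ∀ (c' : S.Colour) (k : Fin (S.ns c')), ∃ γ : Matrix (Fin (S.n c')) (Fin (S.n c')) K,
      ∀ s ℓ, u (S.vec ⟨c', (s, ℓ), k⟩) = ∑ ℓ', γ ℓ' ℓ • S.vec ⟨c', (s, ℓ'), k⟩ := by
    intro c' k
    by_cases h : c' = c
    · subst c'
      have hk := S.side_eq_sideZero hc k
      subst hk
      exact ⟨g, fun s ℓ => by simp_rw [S.vec_zero]; exact hu1 s ℓ⟩
    · refine ⟨1, fun s ℓ => ?_⟩
      rw [hu2 _ h]
      simp_rw [Matrix.one_apply, ite_smul, one_smul, zero_smul, Finset.sum_ite_eq', Finset.mem_univ,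
        if_true]
  refine ⟨S.commute_of_units u (fun c₀ a b => S.commute_of_fibrewise u _ hu (S.e_fibrewise c₀ a b))
    (fun c₀ hc₀ a b => S.commute_of_fibrewise u _ hu (S.f_fibrewise hc₀ a b)), ?_⟩
  suffices h : S.B.comp u u = S.B by
    intro v w
    have := LinearMap.congr_fun (LinearMap.congr_fun h v) w
    rwa [LinearMap.BilinForm.comp_apply] at this
  refine LinearMap.BilinForm.ext_basis S.basisJ fun q q' => ?_
  rw [LinearMap.BilinForm.comp_apply, basisJ_apply, basisJ_apply]
  by_cases hq : q.1 = c <;> by_cases hq' : q'.1 = c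
  · obtain ⟨c₁, ⟨b, ℓ⟩, k⟩ := q
    obtain ⟨c₂, ⟨b', ℓ'⟩, k'⟩ := q'
    dsimp only at hq hq'
    subst c₁
    subst c₂
    have hk := S.side_eq_sideZero hc k
    have hk' := S.side_eq_sideZero hc k'
    subst hk; subst hk'
    rw [S.vec_zero, S.vec_zero, hu1, hu1, S.B_sum_smul_sum_smul]
    simp_rw [S.B_x_x c hc]
    have h := congrFun (congrFun hg ℓ) ℓ'
    simp only [Matrix.mul_apply, Matrix.transpose_apply] at h
    rw [← h, Finset.mul_sum, Finset.sum_comm]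
    refine Finset.sum_congr rfl fun a' _ => ?_
    rw [Finset.sum_mul, Finset.mul_sum]
    refine Finset.sum_congr rfl fun a _ => ?_
    ring
  · rw [hu2 _ hq']
    obtain ⟨c₁, ⟨b, ℓ⟩, k⟩ := q
    dsimp only at hq
    subst c₁
    have hk := S.side_eq_sideZero hc k
    subst hk
    rw [S.vec_zero, hu1]
    simp_rw [← S.vec_zero]
    rw [S.B_sum_vec_ne q' c hq', S.B_vec_vec_ne _ _ (Ne.symm hq')]
  · rw [hu2 _ hq]
    obtain ⟨c₂, ⟨b', ℓ'⟩, k'⟩ := q'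
    dsimp only at hq'
    subst c₂
    have hk' := S.side_eq_sideZero hc k'
    subst hk'
    rw [S.vec_zero, hu1]
    simp_rw [← S.vec_zero]
    rw [S.B_vec_sum_ne q c hq, S.B_vec_vec_ne _ _ hq]
  · rw [hu2 _ hq, hu2 _ hq']

end Form

/-! ### Pair colours -/

section Pair

variable {c : S.Colour} (hc : ¬ S.IsForm c)

include hc in
/-- **Pair-colour kernels** (Milne Prop. 3.6 (c)): the contraction operator of the cross kernel of slots
`(s, s')` is `e_{s s'} + f_{s' s} ∈ E`. [cite: Milne1999LefschetzClasses, §3 Prop. 3.6 (c)] -/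
theorem pair_kernel (s s' : Fin (S.d c.1)) : ∃ X ∈ S.E, ∀ v,
    X v = ∑ a, (S.B v (S.y c s' a) • S.x c s a - S.B v (S.x c s a) • S.y c s' a) := by
  refine ⟨S.e c s s' + S.f c s' s, S.E.add_mem (S.e_mem c s s') (S.f_mem c s' s), ?_⟩
  let T : Module.End K V := ∑ a,
    ((S.B.flip (S.y c s' a)).smulRight (S.x c s a) - (S.B.flip (S.x c s a)).smulRight (S.y c s' a))
  have hT' : ∀ v, T v = ∑ a, (S.B v (S.y c s' a) • S.x c s a - S.B v (S.x c s a) • S.y c s' a) := by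
    intro v
    simp only [T, LinearMap.sum_apply, LinearMap.sub_apply, LinearMap.smulRight_apply,
      LinearMap.BilinForm.flip_apply]
  suffices h : S.e c s s' + S.f c s' s = T by intro v; rw [h, hT']
  refine S.basisJ.ext fun q => ?_
  rw [basisJ_apply, hT', LinearMap.add_apply]
  by_cases hq : q.1 = c
  · obtain ⟨c', ⟨b, ℓ⟩, k⟩ := q
    dsimp only at hq
    subst hq
    by_cases hk : (k : ℕ) = 0
    · have hk' : k = S.sideZero c' := Fin.ext hk
      subst hk'
      rw [S.vec_zero, S.e_x, S.f_x hc, add_zero]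
      simp_rw [S.B_x_y, S.B_x_x_of_not_isForm hc, zero_smul, sub_zero, ite_smul, one_smul, zero_smul]
      by_cases hb : s' = b
      · subst hb
        rw [if_pos rfl]
        simp_rw [true_and, Finset.sum_ite_eq, Finset.mem_univ, if_true]
      · rw [if_neg hb]
        simp_rw [show ∀ a, ¬(b = s' ∧ ℓ = a) from fun a h => hb h.1.symm, if_false,
          Finset.sum_const_zero]
    · have hk' : k = S.sideOne hc := S.side_eq_of_ne_zero k _ hk (by simp [sideOne])
      subst hk'
      rw [S.vec_one hc, S.e_y hc, S.f_y, zero_add]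
      simp_rw [S.B_y_y_of_not_isForm hc, S.B_y_x, zero_smul, zero_sub, neg_smul, neg_neg, ite_smul,
        one_smul, zero_smul]
      by_cases hb : s = b
      · subst hb
        rw [if_pos rfl]
        simp_rw [true_and]
        simp_rw [show ∀ a, (a = ℓ) = (ℓ = a) from fun a => propext eq_comm]
        rw [Finset.sum_ite_eq, if_pos (Finset.mem_univ _)]
      · rw [if_neg hb]
        simp_rw [show ∀ a, ¬(s = b ∧ a = ℓ) from fun a h => hb h.1, if_false, Finset.sum_const_zero]
  · have h0 : ∀ (t : Fin (S.d c.1)) (a : Fin (S.n c)), S.B (S.vec q) (S.x c t a) = 0 := by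
      intro t a; rw [← S.vec_zero]; exact S.B_vec_vec_ne q _ hq
    have h0' : ∀ (t : Fin (S.d c.1)) (a : Fin (S.n c)), S.B (S.vec q) (S.y c t a) = 0 := by
      intro t a; rw [← S.vec_one hc]; exact S.B_vec_vec_ne q _ hq
    simp_rw [h0, h0', zero_smul, sub_zero, Finset.sum_const_zero]
    obtain ⟨c', ⟨b, ℓ⟩, k⟩ := q
    dsimp only at hq
    unfold vec
    dsimp only
    split_ifs
    · rw [S.e_x_ne (Ne.symm hq), S.f_x_ne (Ne.symm hq), add_zero]
    · rw [S.e_y_ne (Ne.symm hq), S.f_y_ne (Ne.symm hq), add_zero]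

include hc in
/-- **Pair-colour group elements**: `g` on the vector letters, `(g⁻¹)ᵀ` on the covector letters, slot by slot,
identity elsewhere, is an `E`-linear `B`-isometry (`GL(W)` on `W ⊕ W^∨`, [Milne 1999, §2]).
[cite: Milne1999LefschetzClasses, §2 p. 650 and Prop. 3.6 (c)] -/
theorem pair_group (g : GL (Fin (S.n c)) K) (u : Module.End K V)
    (hu1 : ∀ s a, u (S.x c s a) = ∑ a', (g : Matrix (Fin (S.n c)) (Fin (S.n c)) K) a' a • S.x c s a')
    (hu1' : ∀ s b, u (S.y c s b) =
      ∑ b', (((g⁻¹ : GL (Fin (S.n c)) K) : Matrix (Fin (S.n c)) (Fin (S.n c)) K)ᵀ) b' b • S.y c s b')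
    (hu2 : ∀ q : S.J, q.1 ≠ c → u (S.vec q) = S.vec q) :
    (∀ X ∈ S.E, X * u = u * X) ∧ ∀ v w, S.B (u v) (u w) = S.B v w := by
  have hgg : ((g⁻¹ : GL (Fin (S.n c)) K) : Matrix (Fin (S.n c)) (Fin (S.n c)) K) *
      (g : Matrix (Fin (S.n c)) (Fin (S.n c)) K) = 1 := by
    rw [← Units.val_mul, inv_mul_cancel, Units.val_one]
  have hu : ∀ (c' : S.Colour) (k : Fin (S.ns c')), ∃ γ : Matrix (Fin (S.n c')) (Fin (S.n c')) K,
      ∀ s ℓ, u (S.vec ⟨c', (s, ℓ), k⟩) = ∑ ℓ', γ ℓ' ℓ • S.vec ⟨c', (s, ℓ'), k⟩ := by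
    intro c' k
    by_cases h : c' = c
    · subst c'
      by_cases hk : (k : ℕ) = 0
      · have hk' : k = S.sideZero c := Fin.ext hk
        subst hk'
        exact ⟨(g : Matrix (Fin (S.n c)) (Fin (S.n c)) K), fun s ℓ => by simp_rw [S.vec_zero]; exact hu1 s ℓ⟩
      · have hk' : k = S.sideOne hc := S.side_eq_of_ne_zero k _ hk (by simp [sideOne])
        subst hk'
        exact ⟨((g⁻¹ : GL (Fin (S.n c)) K) : Matrix (Fin (S.n c)) (Fin (S.n c)) K)ᵀ,
          fun s ℓ => by simp_rw [S.vec_one hc]; exact hu1' s ℓ⟩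
    · refine ⟨1, fun s ℓ => ?_⟩
      rw [hu2 _ h]
      simp_rw [Matrix.one_apply, ite_smul, one_smul, zero_smul, Finset.sum_ite_eq', Finset.mem_univ,
        if_true]
  refine ⟨S.commute_of_units u (fun c₀ a b => S.commute_of_fibrewise u _ hu (S.e_fibrewise c₀ a b))
    (fun c₀ hc₀ a b => S.commute_of_fibrewise u _ hu (S.f_fibrewise hc₀ a b)), ?_⟩
  suffices h : S.B.comp u u = S.B by
    intro v w
    have := LinearMap.congr_fun (LinearMap.congr_fun h v) w
    rwa [LinearMap.BilinForm.comp_apply] at this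
  refine LinearMap.BilinForm.ext_basis S.basisJ fun q q' => ?_
  rw [LinearMap.BilinForm.comp_apply, basisJ_apply, basisJ_apply]
  -- the values of `u` on the vectors of colour `c`, as fibre combinations
  have key : ∀ (b : Fin (S.d c.1)) (ℓ : Fin (S.n c)) (k : Fin (S.ns c)), ∃ γ : Fin (S.n c) → K,
      u (S.vec ⟨c, (b, ℓ), k⟩) = ∑ a, γ a • S.vec ⟨c, (b, a), k⟩ := by
    intro b ℓ k
    obtain ⟨γ, hγ⟩ := hu c k
    exact ⟨fun a => γ a ℓ, hγ b ℓ⟩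
  by_cases hq : q.1 = c <;> by_cases hq' : q'.1 = c
  · obtain ⟨c₁, ⟨b, ℓ⟩, k⟩ := q
    obtain ⟨c₂, ⟨b', ℓ'⟩, k'⟩ := q'
    dsimp only at hq hq'
    subst c₁
    subst c₂
    by_cases hk : (k : ℕ) = 0 <;> by_cases hk' : (k' : ℕ) = 0
    · have h1 : k = S.sideZero c := Fin.ext hk
      have h2 : k' = S.sideZero c := Fin.ext hk'
      subst h1; subst h2
      rw [S.vec_zero, S.vec_zero, hu1, hu1, S.B_sum_smul_sum_smul]
      simp_rw [S.B_x_x_of_not_isForm hc, mul_zero, Finset.sum_const_zero]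
    · have h1 : k = S.sideZero c := Fin.ext hk
      have h2 : k' = S.sideOne hc := S.side_eq_of_ne_zero k' _ hk' (by simp [sideOne])
      subst h1; subst h2
      rw [S.vec_zero, S.vec_one hc, hu1, hu1', S.B_sum_smul_sum_smul]
      simp_rw [S.B_x_y]
      by_cases hb : b = b'
      · subst hb
        have e2 : (if b = b ∧ ℓ = ℓ' then (1 : K) else 0) = if ℓ' = ℓ then 1 else 0 := by
          by_cases h : ℓ = ℓ'
          · rw [if_pos ⟨rfl, h⟩, if_pos h.symm]
          · rw [if_neg fun hh => h hh.2, if_neg fun hh => h hh.symm]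
        have h := congrFun (congrFun hgg ℓ') ℓ
        rw [Matrix.mul_apply, Matrix.one_apply] at h
        rw [e2, ← h]
        refine Finset.sum_congr rfl fun a _ => ?_
        rw [Finset.sum_eq_single a]
        · rw [if_pos ⟨rfl, rfl⟩, mul_one, Matrix.transpose_apply, mul_comm]
        · intro a' _ ha'
          rw [if_neg (fun hh => ha' hh.2.symm), mul_zero]
        · intro ha
          exact absurd (Finset.mem_univ a) ha
      · have e1 : ∀ a a' : Fin (S.n c), (if b = b' ∧ a = a' then (1 : K) else 0) = 0 :=
          fun a a' => if_neg fun h => hb h.1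
        simp_rw [e1, mul_zero, Finset.sum_const_zero]
    · have h1 : k = S.sideOne hc := S.side_eq_of_ne_zero k _ hk (by simp [sideOne])
      have h2 : k' = S.sideZero c := Fin.ext hk'
      subst h1; subst h2
      rw [S.vec_one hc, S.vec_zero, hu1', hu1, S.B_sum_smul_sum_smul]
      simp_rw [S.B_y_x]
      by_cases hb : b' = b
      · subst hb
        have e2 : (if b' = b' ∧ ℓ' = ℓ then (1 : K) else 0) = if ℓ = ℓ' then 1 else 0 := by
          by_cases h : ℓ' = ℓ
          · rw [if_pos ⟨rfl, h⟩, if_pos h.symm]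
          · rw [if_neg fun hh => h hh.2, if_neg fun hh => h hh.symm]
        have h := congrFun (congrFun hgg ℓ) ℓ'
        rw [Matrix.mul_apply, Matrix.one_apply] at h
        rw [e2, ← h, ← Finset.sum_neg_distrib]
        refine Finset.sum_congr rfl fun a _ => ?_
        rw [Finset.sum_eq_single a]
        · rw [if_pos ⟨rfl, rfl⟩, Matrix.transpose_apply]
          ring
        · intro a' _ ha'
          rw [if_neg (fun hh => ha' hh.2), neg_zero, mul_zero]
        · intro ha
          exact absurd (Finset.mem_univ a) ha
      · have e1 : ∀ a a' : Fin (S.n c), (if b' = b ∧ a' = a then (1 : K) else 0) = 0 :=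
          fun a a' => if_neg fun h => hb h.1
        simp_rw [e1, neg_zero, mul_zero, Finset.sum_const_zero]
    · have h1 : k = S.sideOne hc := S.side_eq_of_ne_zero k _ hk (by simp [sideOne])
      have h2 : k' = S.sideOne hc := S.side_eq_of_ne_zero k' _ hk' (by simp [sideOne])
      subst h1; subst h2
      rw [S.vec_one hc, S.vec_one hc, hu1', hu1', S.B_sum_smul_sum_smul]
      simp_rw [S.B_y_y_of_not_isForm hc, mul_zero, Finset.sum_const_zero]
  · rw [hu2 _ hq']
    obtain ⟨c₁, ⟨b, ℓ⟩, k⟩ := q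
    dsimp only at hq
    subst c₁
    obtain ⟨γ, hγ⟩ := key b ℓ k
    rw [hγ, S.B_sum_vec_ne q' c hq', S.B_vec_vec_ne _ _ (Ne.symm hq')]
  · rw [hu2 _ hq]
    obtain ⟨c₂, ⟨b', ℓ'⟩, k'⟩ := q'
    dsimp only at hq'
    subst c₂
    obtain ⟨γ, hγ⟩ := key b' ℓ' k'
    rw [hγ, S.B_vec_sum_ne q c hq, S.B_vec_vec_ne _ _ hq]
  · rw [hu2 _ hq, hu2 _ hq']

end Pair

/-! ### Packaging in the vocabulary of `TensorFFTLetterColoured` -/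

/-- The colour of a letter. [cite: Milne1999LefschetzClasses, §2] -/
def lcol (j : Fin S.N) : S.Colour := (S.eJ.symm j).1

/-- The lettering of side `0` of a colour. [cite: Milne1999LefschetzClasses, §2] -/
def ltr (c : S.Colour) (p : Fin (S.d c.1) × Fin (S.n c)) : Fin S.N := S.eJ ⟨c, p, S.sideZero c⟩

/-- The lettering of side `1` of a pair colour. [cite: Milne1999LefschetzClasses, §2] -/
def ltr₁ {c : S.Colour} (hc : ¬ S.IsForm c) (p : Fin (S.d c.1) × Fin (S.n c)) : Fin S.N :=
  S.eJ ⟨c, p, S.sideOne hc⟩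

/-- Basis vectors of side-`0` letters. [folklore] -/
@[simp] private theorem β_ltr (c : S.Colour) (p : Fin (S.d c.1) × Fin (S.n c)) : S.β (S.ltr c p) = S.x c p.1 p.2 := by
  rw [ltr, β_eJ, vec_zero]

/-- Basis vectors of side-`1` letters. [folklore] -/
@[simp] private theorem β_ltr₁ {c : S.Colour} (hc : ¬ S.IsForm c) (p : Fin (S.d c.1) × Fin (S.n c)) :
    S.β (S.ltr₁ hc p) = S.y c p.1 p.2 := by
  rw [ltr₁, β_eJ, vec_one]

/-- `ltr` is injective. [folklore] -/
private theorem ltr_injective (c : S.Colour) : Function.Injective (S.ltr c) := by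
  intro p p' h
  have h2 := S.eJ.injective h
  obtain ⟨-, h3⟩ := Sigma.mk.inj_iff.1 h2
  exact ((Prod.mk.injEq _ _ _ _).mp (eq_of_heq h3)).1

/-- `ltr₁` is injective. [folklore] -/
private theorem ltr₁_injective {c : S.Colour} (hc : ¬ S.IsForm c) : Function.Injective (S.ltr₁ hc) := by
  intro p p' h
  have h2 := S.eJ.injective h
  obtain ⟨-, h3⟩ := Sigma.mk.inj_iff.1 h2
  exact ((Prod.mk.injEq _ _ _ _).mp (eq_of_heq h3)).1

/-- `ltr` and `ltr₁` have disjoint images. [folklore] -/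
private theorem ltr_ne_ltr₁ {c : S.Colour} (hc : ¬ S.IsForm c) (p p' : Fin (S.d c.1) × Fin (S.n c)) :
    S.ltr c p ≠ S.ltr₁ hc p' := by
  intro h
  have h2 := S.eJ.injective h
  obtain ⟨-, h3⟩ := Sigma.mk.inj_iff.1 h2
  have h4 := ((Prod.mk.injEq _ _ _ _).mp (eq_of_heq h3)).2
  have h5 := congrArg Fin.val h4
  simp [sideZero, sideOne] at h5

/-- Joint injectivity of the two letterings of a pair colour. [folklore] -/
private theorem sum_elim_injective {c : S.Colour} (hc : ¬ S.IsForm c) :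
    Function.Injective (Sum.elim (S.ltr c) (S.ltr₁ hc)) := by
  rintro (p | p) (p' | p') h
  · exact congrArg Sum.inl (S.ltr_injective c h)
  · exact absurd h (S.ltr_ne_ltr₁ hc p p')
  · exact absurd h.symm (S.ltr_ne_ltr₁ hc p' p)
  · exact congrArg Sum.inr (S.ltr₁_injective hc h)

/-- Colour of a side-`0` letter. [folklore] -/
@[simp] private theorem lcol_ltr (c : S.Colour) (p : Fin (S.d c.1) × Fin (S.n c)) : S.lcol (S.ltr c p) = c := by
  simp [lcol, ltr]

/-- Colour of a side-`1` letter. [folklore] -/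
@[simp] private theorem lcol_ltr₁ {c : S.Colour} (hc : ¬ S.IsForm c) (p : Fin (S.d c.1) × Fin (S.n c)) :
    S.lcol (S.ltr₁ hc p) = c := by
  simp [lcol, ltr₁]

/-- The letters of a form colour. [cite: Milne1999LefschetzClasses, §2] -/
theorem range_ltr {c : S.Colour} (hc : S.IsForm c) : Set.range (S.ltr c) = {j | S.lcol j = c} := by
  ext j
  constructor
  · rintro ⟨p, rfl⟩; exact S.lcol_ltr c p
  · intro hj
    rcases hq : S.eJ.symm j with ⟨c', p, k⟩
    have hc' : c' = c := by
      change (S.eJ.symm j).1 = c at hj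
      rw [hq] at hj
      exact hj
    subst c'
    have hk := S.side_eq_sideZero hc k
    subst hk
    exact ⟨p, by rw [ltr, ← hq, Equiv.apply_symm_apply]⟩

/-- The letters of a pair colour. [cite: Milne1999LefschetzClasses, §2] -/
theorem range_union {c : S.Colour} (hc : ¬ S.IsForm c) :
    Set.range (S.ltr c) ∪ Set.range (S.ltr₁ hc) = {j | S.lcol j = c} := by
  ext j
  constructor
  · rintro (⟨p, rfl⟩ | ⟨p, rfl⟩)
    · exact S.lcol_ltr c p
    · exact S.lcol_ltr₁ hc p
  · intro hj
    rcases hq : S.eJ.symm j with ⟨c', p, k⟩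
    have hc' : c' = c := by
      change (S.eJ.symm j).1 = c at hj
      rw [hq] at hj
      exact hj
    subst c'
    by_cases hk : (k : ℕ) = 0
    · have hk' : k = S.sideZero c := Fin.ext hk
      subst hk'
      exact Or.inl ⟨p, by rw [ltr, ← hq, Equiv.apply_symm_apply]⟩
    · have hk' : k = S.sideOne hc := S.side_eq_of_ne_zero k _ hk (by simp [sideOne])
      subst hk'
      exact Or.inr ⟨p, by rw [ltr₁, ← hq, Equiv.apply_symm_apply]⟩

/-- A double sum against an indicator of one point. [folklore] -/
private theorem sum_sum_ite_eq {α₁ α₂ W : Type*} [Fintype α₁] [Fintype α₂] [DecidableEq α₁] [DecidableEq α₂]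
    [AddCommMonoid W] (A : α₁) (A' : α₂) (G : α₁ → α₂ → W) :
    ∑ j, ∑ j', (if j = A ∧ j' = A' then G j j' else 0) = G A A' := by
  rw [Finset.sum_eq_single A]
  · rw [Finset.sum_eq_single A']
    · rw [if_pos ⟨rfl, rfl⟩]
    · intro j' _ hj'; exact if_neg fun h => hj' h.2
    · intro h; exact absurd (Finset.mem_univ _) h
  · intro j _ hj; exact Finset.sum_eq_zero fun j' _ => if_neg fun h => hj h.1
  · intro h; exact absurd (Finset.mem_univ _) h

/-- Contracting against a slot kernel. [cite: Milne1999LefschetzClasses, §3 p. 654] -/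
theorem sum_slotKernel_smul {W : Type*} [AddCommGroup W] [Module K W] {m n N : ℕ}
    (ltr : Fin m × Fin n → Fin N) (Θ : Matrix (Fin n) (Fin n) K) (s s' : Fin m) (F : Fin N → Fin N → W) :
    ∑ j, ∑ j', slotKernel ltr Θ s s' j j' • F j j' = ∑ a, ∑ a', Θ a a' • F (ltr (s, a)) (ltr (s', a')) := by
  classical
  have h : ∀ j j', slotKernel ltr Θ s s' j j' • F j j' =
      ∑ a, ∑ a', (if j = ltr (s, a) ∧ j' = ltr (s', a') then Θ a a' • F j j' else 0) := by
    intro j j'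
    rw [slotKernel, Finset.sum_smul]
    refine Finset.sum_congr rfl fun a _ => ?_
    rw [Finset.sum_smul]
    refine Finset.sum_congr rfl fun a' _ => ?_
    split_ifs <;> simp
  simp_rw [h]
  calc ∑ j, ∑ j', ∑ a, ∑ a', (if j = ltr (s, a) ∧ j' = ltr (s', a') then Θ a a' • F j j' else 0)
      = ∑ j, ∑ a, ∑ j', ∑ a', (if j = ltr (s, a) ∧ j' = ltr (s', a') then Θ a a' • F j j' else 0) :=
        Finset.sum_congr rfl fun j _ => Finset.sum_comm
    _ = ∑ a, ∑ j, ∑ j', ∑ a', (if j = ltr (s, a) ∧ j' = ltr (s', a') then Θ a a' • F j j' else 0) :=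
        Finset.sum_comm
    _ = ∑ a, ∑ j, ∑ a', ∑ j', (if j = ltr (s, a) ∧ j' = ltr (s', a') then Θ a a' • F j j' else 0) :=
        Finset.sum_congr rfl fun a _ => Finset.sum_congr rfl fun j _ => Finset.sum_comm
    _ = ∑ a, ∑ a', ∑ j, ∑ j', (if j = ltr (s, a) ∧ j' = ltr (s', a') then Θ a a' • F j j' else 0) :=
        Finset.sum_congr rfl fun a _ => Finset.sum_comm
    _ = ∑ a, ∑ a', Θ a a' • F (ltr (s, a)) (ltr (s', a')) :=
        Finset.sum_congr rfl fun a _ => Finset.sum_congr rfl fun a' _ =>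
          sum_sum_ite_eq _ _ fun j j' => Θ a a' • F j j'

/-- Contracting against a cross kernel. [cite: Milne1999LefschetzClasses, §3 Prop. 3.6 (c)] -/
theorem sum_crossKernel_smul {W : Type*} [AddCommGroup W] [Module K W] {m n N : ℕ}
    (vec cov : Fin m × Fin n → Fin N) (s s' : Fin m) (F : Fin N → Fin N → W) :
    ∑ j, ∑ j', crossKernel (K := K) vec cov s s' j j' • F j j' = ∑ a, F (vec (s, a)) (cov (s', a)) := by
  classical
  have h : ∀ j j', crossKernel (K := K) vec cov s s' j j' • F j j' =
      ∑ a, (if j = vec (s, a) ∧ j' = cov (s', a) then F j j' else 0) := by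
    intro j j'
    rw [crossKernel, Finset.sum_smul]
    refine Finset.sum_congr rfl fun a _ => ?_
    split_ifs <;> simp
  simp_rw [h]
  calc ∑ j, ∑ j', ∑ a, (if j = vec (s, a) ∧ j' = cov (s', a) then F j j' else 0)
      = ∑ j, ∑ a, ∑ j', (if j = vec (s, a) ∧ j' = cov (s', a) then F j j' else 0) :=
        Finset.sum_congr rfl fun j _ => Finset.sum_comm
    _ = ∑ a, ∑ j, ∑ j', (if j = vec (s, a) ∧ j' = cov (s', a) then F j j' else 0) := Finset.sum_comm
    _ = ∑ a, F (vec (s, a)) (cov (s', a)) := Finset.sum_congr rfl fun a _ => sum_sum_ite_eq _ _ F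

/-- **Form-colour kernels, packaged.** [cite: Milne1999LefschetzClasses, §3 Prop. 3.6 (a), (b)] -/
theorem formBlockKernels_realised {c : S.Colour} (hc : S.IsForm c) :
    ∀ M ∈ formBlockKernels (S.ltr c) (S.Ω c hc), ∃ X ∈ S.E, ∀ v,
      X v = ∑ j, ∑ j', M j j' • (S.B v (S.β j') • S.β j - S.B v (S.β j) • S.β j') := by
  rintro _ ⟨⟨s, s'⟩, rfl⟩
  obtain ⟨X, hX, hXv⟩ := S.form_kernel c hc s s'
  refine ⟨X, hX, fun v => ?_⟩
  rw [hXv, sum_slotKernel_smul]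
  simp only [β_ltr]

/-- **Pair-colour kernels, packaged.** [cite: Milne1999LefschetzClasses, §3 Prop. 3.6 (c)] -/
theorem glBlockKernels_realised {c : S.Colour} (hc : ¬ S.IsForm c) :
    ∀ M ∈ glBlockKernels (K := K) (S.ltr c) (S.ltr₁ hc), ∃ X ∈ S.E, ∀ v,
      X v = ∑ j, ∑ j', M j j' • (S.B v (S.β j') • S.β j - S.B v (S.β j) • S.β j') := by
  rintro _ ⟨⟨s, s'⟩, rfl⟩
  obtain ⟨X, hX, hXv⟩ := S.pair_kernel hc s s'
  refine ⟨X, hX, fun v => ?_⟩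
  rw [hXv, sum_crossKernel_smul]
  simp only [β_ltr, β_ltr₁]

/-- The matrix of `β` applied through `toLin`, summed over `J`. [folklore] -/
private theorem toLin_β_apply (G : Matrix (Fin S.N) (Fin S.N) K) (q : S.J) :
    Matrix.toLin S.β S.β G (S.vec q) = ∑ q', G (S.eJ q') (S.eJ q) • S.vec q' := by
  rw [← S.β_eJ q, Matrix.toLin_self, ← Equiv.sum_comp S.eJ]
  simp only [β_eJ]

/-- A letter of the fibre of `q` is `eJ q` only if it is in the fibre. [folklore] -/
private theorem eJ_eq_iff (q q' : S.J) : S.eJ q' = S.eJ q ↔ q' = q := S.eJ.apply_eq_iff_eq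

/-- Columns outside a colour are identity columns: `toLin G` fixes the other colours. [folklore] -/
private theorem toLin_vec_of_ne (G : Matrix (Fin S.N) (Fin S.N) K) (q : S.J)
    (hG : ∀ j', G j' (S.eJ q) = (1 : Matrix (Fin S.N) (Fin S.N) K) j' (S.eJ q)) :
    Matrix.toLin S.β S.β G (S.vec q) = S.vec q := by
  rw [S.toLin_β_apply]
  simp_rw [hG, Matrix.one_apply, eJ_eq_iff, ite_smul, one_smul, zero_smul, Finset.sum_ite_eq',
    Finset.mem_univ, if_true]

/-- A letter of colour `≠ c` is not a side-`0` letter of `c`. [folklore] -/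
private theorem eJ_not_mem_range_ltr {c : S.Colour} (q : S.J) (hq : q.1 ≠ c) : S.eJ q ∉ Set.range (S.ltr c) := by
  rintro ⟨p, hp⟩
  apply hq
  have := S.eJ.injective hp
  rw [← this]

/-- A letter of colour `≠ c` is not a side-`1` letter of `c`. [folklore] -/
private theorem eJ_not_mem_range_ltr₁ {c : S.Colour} (hc : ¬ S.IsForm c) (q : S.J) (hq : q.1 ≠ c) :
    S.eJ q ∉ Set.range (S.ltr₁ hc) := by
  rintro ⟨p, hp⟩
  apply hq
  have := S.eJ.injective hp
  rw [← this]

/-- **Form-colour groups, packaged.** [cite: Milne1999LefschetzClasses, §2 and Prop. 3.6 (a), (b)] -/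
theorem formBlockGroup_realised {c : S.Colour} (hc : S.IsForm c) :
    ∀ G ∈ formBlockGroup (S.ltr c) (S.Ω c hc),
      (∀ X ∈ S.E, X * Matrix.toLin S.β S.β G = Matrix.toLin S.β S.β G * X) ∧
        ∀ v w, S.B (Matrix.toLin S.β S.β G v) (Matrix.toLin S.β S.β G w) = S.B v w := by
  rintro G ⟨g, hg, hG1, hG2, hG3⟩
  apply S.form_group c hc g hg
  · intro s a
    rw [← S.vec_zero, S.toLin_β_apply,
      sum_eq_sum_of_support (S.emb c s (S.sideZero c)) (S.emb_injective _ _ _)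
        (fun q' => G (S.eJ q') (S.eJ ⟨c, (s, a), S.sideZero c⟩) • S.vec q') ?_]
    · refine Finset.sum_congr rfl fun a' _ => ?_
      change G (S.ltr c (s, a')) (S.ltr c (s, a)) • S.vec ⟨c, (s, a'), S.sideZero c⟩ = _
      rw [hG1, if_pos rfl, S.vec_zero]
    · intro q' hq'
      change G (S.eJ q') (S.ltr c (s, a)) • S.vec q' = 0
      by_cases hr : S.eJ q' ∈ Set.range (S.ltr c)
      · obtain ⟨⟨s'', a''⟩, hp⟩ := hr
        rw [← hp, hG1]
        by_cases hs : s'' = s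
        · exfalso
          apply hq' a''
          apply S.eJ.injective
          rw [← hp, hs]
          rfl
        · rw [if_neg hs, zero_smul]
      · rw [hG3 _ _ hr, Matrix.one_apply, if_neg, zero_smul]
        intro h
        exact hr ⟨(s, a), h.symm⟩
  · intro q hq
    exact S.toLin_vec_of_ne G q fun j' => hG2 _ _ (S.eJ_not_mem_range_ltr q hq)

/-- **Pair-colour groups, packaged.** [cite: Milne1999LefschetzClasses, §2 and Prop. 3.6 (c)] -/
theorem glBlockGroup_realised {c : S.Colour} (hc : ¬ S.IsForm c) :
    ∀ G ∈ glBlockGroup (K := K) (S.ltr c) (S.ltr₁ hc),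
      (∀ X ∈ S.E, X * Matrix.toLin S.β S.β G = Matrix.toLin S.β S.β G * X) ∧
        ∀ v w, S.B (Matrix.toLin S.β S.β G v) (Matrix.toLin S.β S.β G w) = S.B v w := by
  rintro G ⟨g, hG1, hG2, hG3, hG4, hG5, hG6⟩
  apply S.pair_group hc g
  · intro s a
    rw [← S.vec_zero, S.toLin_β_apply,
      sum_eq_sum_of_support (S.emb c s (S.sideZero c)) (S.emb_injective _ _ _)
        (fun q' => G (S.eJ q') (S.eJ ⟨c, (s, a), S.sideZero c⟩) • S.vec q') ?_]
    · refine Finset.sum_congr rfl fun a' _ => ?_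
      change G (S.ltr c (s, a')) (S.ltr c (s, a)) • S.vec ⟨c, (s, a'), S.sideZero c⟩ = _
      rw [hG1, if_pos rfl, S.vec_zero]
    · intro q' hq'
      change G (S.eJ q') (S.ltr c (s, a)) • S.vec q' = 0
      by_cases hr : S.eJ q' ∈ Set.range (S.ltr c)
      · obtain ⟨⟨s'', a''⟩, hp⟩ := hr
        rw [← hp, hG1]
        by_cases hs : s'' = s
        · exfalso
          apply hq' a''
          apply S.eJ.injective
          rw [← hp, hs]
          rfl
        · rw [if_neg hs, zero_smul]
      · by_cases hr' : S.eJ q' ∈ Set.range (S.ltr₁ hc)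
        · obtain ⟨⟨s'', b''⟩, hp⟩ := hr'
          rw [← hp, hG3, zero_smul]
        · rw [hG6 _ _ hr hr', Matrix.one_apply, if_neg, zero_smul]
          intro h
          exact hr ⟨(s, a), h.symm⟩
  · intro s b
    rw [← S.vec_one hc, S.toLin_β_apply,
      sum_eq_sum_of_support (S.emb c s (S.sideOne hc)) (S.emb_injective _ _ _)
        (fun q' => G (S.eJ q') (S.eJ ⟨c, (s, b), S.sideOne hc⟩) • S.vec q') ?_]
    · refine Finset.sum_congr rfl fun b' _ => ?_
      change G (S.ltr₁ hc (s, b')) (S.ltr₁ hc (s, b)) • S.vec ⟨c, (s, b'), S.sideOne hc⟩ = _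
      rw [hG2, if_pos rfl, S.vec_one]
    · intro q' hq'
      change G (S.eJ q') (S.ltr₁ hc (s, b)) • S.vec q' = 0
      by_cases hr : S.eJ q' ∈ Set.range (S.ltr₁ hc)
      · obtain ⟨⟨s'', b''⟩, hp⟩ := hr
        rw [← hp, hG2]
        by_cases hs : s'' = s
        · exfalso
          apply hq' b''
          apply S.eJ.injective
          rw [← hp, hs]
          rfl
        · rw [if_neg hs, zero_smul]
      · by_cases hr' : S.eJ q' ∈ Set.range (S.ltr c)
        · obtain ⟨⟨s'', a''⟩, hp⟩ := hr'
          rw [← hp, hG4, zero_smul]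
        · rw [hG6 _ _ hr' hr, Matrix.one_apply, if_neg, zero_smul]
          intro h
          exact hr ⟨(s, b), h.symm⟩
  · intro q hq
    exact S.toLin_vec_of_ne G q fun j' =>
      hG5 _ _ (S.eJ_not_mem_range_ltr q hq) (S.eJ_not_mem_range_ltr₁ hc q hq)

/-- The second lettering, made total (equal to the first on form colours, where it is not used). [folklore] -/
def ltr₁' (c : S.Colour) (p : Fin (S.d c.1) × Fin (S.n c)) : Fin S.N :=
  if hc : S.IsForm c then S.ltr c p else S.ltr₁ hc p

/-- The letter form, made total (`0` on pair colours, where it is not used). [folklore] -/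
def Ω' (c : S.Colour) : Matrix (Fin (S.n c)) (Fin (S.n c)) K :=
  if hc : S.IsForm c then S.Ω c hc else 0

/-- `ltr₁'` on pair colours. [folklore] -/
private theorem ltr₁'_eq {c : S.Colour} (hc : ¬ S.IsForm c) : S.ltr₁' c = S.ltr₁ hc := by
  funext p; simp [ltr₁', hc]

/-- `Ω'` on form colours. [folklore] -/
private theorem Ω'_eq {c : S.Colour} (hc : S.IsForm c) : S.Ω' c = S.Ω c hc := by
  simp [Ω', hc]

end Setup

/-! ### The adapted colouring -/

/-- **An adapted letter colouring** of `(V, B, E)`: a basis `β` of `V` indexed by `Fin N`, a finite set of colours,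
each either a *form colour* (letters `ltr i (s, a)`, letter form `Ω i`: the block group `formBlockGroup` consists of
matrices of `E`-linear `B`-isometries and the kernels `formBlockKernels` are contraction matrices of elements of `E`)
or a *pair colour* (letters `ltr i`, `ltr₁ i`; same with `glBlockGroup` / `glBlockKernels`) — the output of the
structure theory of [Milne 1999, §2] in the vocabulary of `TensorFFTLetterColoured`.
[cite: Milne1999LefschetzClasses, §2–§3] -/
structure AdaptedColouring (B : LinearMap.BilinForm K V) (E : Subalgebra K (Module.End K V)) where
  /-- number of letters -/
  N : ℕ
  /-- the adapted basis -/
  β : Module.Basis (Fin N) K V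
  /-- the colours -/
  ι : Type
  /-- finitely many colours -/
  [instFintype : Fintype ι]
  /-- decidable equality of colours -/
  [instDecEq : DecidableEq ι]
  /-- the colour of a letter -/
  lcol : Fin N → ι
  /-- form colours -/
  IsForm : ι → Prop
  /-- decidability of being a form colour -/
  [instDec : DecidablePred IsForm]
  /-- number of slots -/
  m : ι → ℕ
  /-- number of letters per slot -/
  n : ι → ℕ
  /-- first lettering -/
  ltr : (i : ι) → Fin (m i) × Fin (n i) → Fin N
  /-- second lettering (pair colours) -/
  ltr₁ : (i : ι) → Fin (m i) × Fin (n i) → Fin N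
  /-- letter form (form colours) -/
  Ω : (i : ι) → Matrix (Fin (n i)) (Fin (n i)) K
  /-- `ltr` is injective on a form colour -/
  ltr_injective : ∀ i, IsForm i → Function.Injective (ltr i)
  /-- the letters of a form colour -/
  range_ltr : ∀ i, IsForm i → Set.range (ltr i) = {j | lcol j = i}
  /-- the letter form is alternating or symmetric -/
  Ω_isAlt_or_isSymm : ∀ i, IsForm i → (Matrix.toBilin' (Ω i)).IsAlt ∨ (Matrix.toBilin' (Ω i)).IsSymm
  /-- the letter form is non-degenerate -/
  Ω_nondegenerate : ∀ i, IsForm i → (Matrix.toBilin' (Ω i)).Nondegenerate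
  /-- block group elements of a form colour are `E`-linear `B`-isometries -/
  form_group : ∀ i, IsForm i → ∀ G ∈ formBlockGroup (ltr i) (Ω i),
    (∀ X ∈ E, X * Matrix.toLin β β G = Matrix.toLin β β G * X) ∧
      ∀ v w, B (Matrix.toLin β β G v) (Matrix.toLin β β G w) = B v w
  /-- kernels of a form colour are contraction matrices of elements of `E` -/
  form_kernel : ∀ i, IsForm i → ∀ M ∈ formBlockKernels (ltr i) (Ω i), ∃ X ∈ E, ∀ v,
    X v = ∑ j, ∑ j', M j j' • (B v (β j') • β j - B v (β j) • β j')
  /-- the two letterings of a pair colour are jointly injective -/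
  sum_injective : ∀ i, ¬ IsForm i → Function.Injective (Sum.elim (ltr i) (ltr₁ i))
  /-- the letters of a pair colour -/
  range_union : ∀ i, ¬ IsForm i → Set.range (ltr i) ∪ Set.range (ltr₁ i) = {j | lcol j = i}
  /-- block group elements of a pair colour are `E`-linear `B`-isometries -/
  pair_group : ∀ i, ¬ IsForm i → ∀ G ∈ glBlockGroup (K := K) (ltr i) (ltr₁ i),
    (∀ X ∈ E, X * Matrix.toLin β β G = Matrix.toLin β β G * X) ∧
      ∀ v w, B (Matrix.toLin β β G v) (Matrix.toLin β β G w) = B v w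
  /-- kernels of a pair colour are contraction matrices of elements of `E` -/
  pair_kernel : ∀ i, ¬ IsForm i → ∀ M ∈ glBlockKernels (K := K) (ltr i) (ltr₁ i), ∃ X ∈ E, ∀ v,
    X v = ∑ j, ∑ j', M j j' • (B v (β j') • β j - B v (β j) • β j')

namespace Setup

variable (S : Setup K V)

/-- **The adapted colouring of a setup.** [cite: Milne1999LefschetzClasses, §2–§3] -/
def adaptedColouring [CharZero K] : AdaptedColouring S.B S.E where
  N := S.N
  β := S.β
  ι := S.Colour
  lcol := S.lcol
  IsForm := S.IsForm
  m := fun c => S.d c.1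
  n := S.n
  ltr := S.ltr
  ltr₁ := S.ltr₁'
  Ω := S.Ω'
  ltr_injective := fun c _ => S.ltr_injective c
  range_ltr := fun _ hc => S.range_ltr hc
  Ω_isAlt_or_isSymm := fun c hc => by rw [S.Ω'_eq hc]; exact S.Ω_isAlt_or_isSymm c hc
  Ω_nondegenerate := fun c hc => by rw [S.Ω'_eq hc]; exact S.Ω_nondegenerate c hc
  form_group := fun c hc => by rw [S.Ω'_eq hc]; exact S.formBlockGroup_realised hc
  form_kernel := fun c hc => by rw [S.Ω'_eq hc]; exact S.formBlockKernels_realised hc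
  sum_injective := fun c hc => by rw [S.ltr₁'_eq hc]; exact S.sum_elim_injective hc
  range_union := fun c hc => by rw [S.ltr₁'_eq hc]; exact S.range_union hc
  pair_group := fun c hc => by rw [S.ltr₁'_eq hc]; exact S.glBlockGroup_realised hc
  pair_kernel := fun c hc => by rw [S.ltr₁'_eq hc]; exact S.glBlockKernels_realised hc

end Setup

/-- **Existence of an adapted colouring** for a non-degenerate alternating form `B` (characteristic `0`) and a
split semisimple `†`-stable algebra of operators `E` — the structure theorem of [Milne 1999, §2] with the
degree-`2` generation data of [Milne 1999, Prop. 3.6, Thm. 3.2] colour by colour.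
[cite: Milne1999LefschetzClasses, §2 and Prop. 3.6] -/
theorem exists_adaptedColouring [CharZero K] (B : LinearMap.BilinForm K V) (hB : B.Nondegenerate)
    (hBa : B.IsAlt) (E : Subalgebra K (Module.End K V))
    (hsplit : ∃ (t : ℕ) (d : Fin t → ℕ), (∀ i, NeZero (d i)) ∧
      Nonempty (E ≃ₐ[K] Π i, Matrix (Fin (d i)) (Fin (d i)) K))
    (hE : ∀ X ∈ E, ∃ Y ∈ E, ∀ v w, B (Y v) w = B v (X w)) : Nonempty (AdaptedColouring B E) := by
  obtain ⟨t, d, hd, ⟨ψ⟩⟩ := hsplit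
  have hE' : ∀ X ∈ E, adj B hB X ∈ E := by
    intro X hX
    obtain ⟨Y, hY, hYX⟩ := hE X hX
    rw [← eq_adj_of_forall B hB hYX]
    exact hY
  exact ⟨(⟨B, hB, hBa, E, hE', t, d, hd, ψ⟩ : Setup K V).adaptedColouring⟩

/-- **Existence of an adapted colouring over an algebraically closed field** of characteristic `0`, for a
finite-dimensional semisimple `†`-stable algebra of operators (Wedderburn–Artin supplies the splitting).
[cite: Milne1999LefschetzClasses, §2 and Prop. 3.6] -/
theorem exists_adaptedColouring_of_isAlgClosed [CharZero K] [IsAlgClosed K] (B : LinearMap.BilinForm K V)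
    (hB : B.Nondegenerate) (hBa : B.IsAlt) (E : Subalgebra K (Module.End K V)) [IsSemisimpleRing E]
    (hE : ∀ X ∈ E, ∃ Y ∈ E, ∀ v w, B (Y v) w = B v (X w)) : Nonempty (AdaptedColouring B E) :=
  exists_adaptedColouring B hB hBa E
    (IsSemisimpleRing.exists_algEquiv_pi_matrix_of_isAlgClosed (F := K) (R := E)) hE

end Literature.RepresentationTheory.ClassicalInvariants

end
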